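import Summits.QuantumFields.YangMills.Theorems.BalabanUVNodesN15CurvedGluingSmoothCutDressedGradientDefectGaugedUNTwistedCross
import Summits.QuantumFields.YangMills.Theorems.BalabanUVNodesN15TwoSpacingGluingCovariant
import Summits.QuantumFields.YangMills.Theorems.BalabanUVNodesN15PerCubeGreenAdjointRows
import Summits.QuantumFields.YangMills.Theorems.BalabanUVNodesN15BackwardShift
import Summits.QuantumFields.YangMills.Theorems.BalabanUVNodesN15PerCubeGreenTwoGridGradientKnitSmall
import Summits.QuantumFields.YangMills.Theorems.BalabanUVNodesN15PerCubeGreenTwoGridSiteFits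
import Summits.QuantumFields.YangMills.Theorems.BalabanUVNodesN15PerCubeGreenTwoGridCutRows
import Summits.QuantumFields.YangMills.Theorems.BalabanUVNodesN15PerCubeGreenTwoGridNonlocalRow
import Summits.QuantumFields.YangMills.Theorems.BalabanUVNodesN15CommutatorOutputSupport
import Summits.QuantumFields.YangMills.Theorems.BalabanUVNodesN15CovariantTwoGridPullbackTwistDataUN
import Summits.QuantumFields.YangMills.Theorems.BalabanUVNodesN15CovariantLandauFlatRowsAllKing
import Summits.QuantumFields.YangMills.Theorems.BalabanUVNodesN15TwoSpacingGluingCutRowsMargin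
import HarnessLib

/-!
# N15 = NE2, road (c) — PROGRAMME (PC) «[B9] Sect. C FOR THE LANDAU LETTER WITH PER-CUBE GAUGES (3.35) AS PRINTED», (PC-E-J) 339J: ★★★ THE TWO-GRID η-DEFECT OF THE GRADIENT ENTRY
# `D_U∘G′(U)` (THE COVARIANT DERIVATIVE OF THE RAW FIELD IN FRONT OF THE SCALAR COVARIANT GREEN's FUNCTION KNIT WITH PER-CUBE GAUGES) THROUGH THE COVARIANT (TWISTED) TRANSPORT:
# n15-c∕411 INSTANTIATED ON THE (PC) SITE CARRIERS OF BOTH GRIDS — every row DISCHARGED BY NAME but n15-c∕339's displayed gauge-group data and the cube-gauge transporter letters (3.35)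
# of the direction `μ₀` on the cube's blocks and their pairing fit (dag-n15-c g35, n15-c∕413)
Cell `pub-ymgap`, seat `pub-ymgap-dag-n15-c` (g35; R134 (a) seat, s1 «first missing estimate»; HUMAN RULING D-0062; chair R424 venue). `bears_on: R4∕N15 · K3⁸ SpineGivenEndpointR13SepCoPHV
(stmt-QuantumFields-27366)`; filed `--kind proof --supports stmt-QuantumFields-27366 --as helper` — COUNT-NEUTRAL.  ONE theorem + one [folklore] fit lemma, 0 `def`, 0 `sorry`; bookkeeping over
landed rows, NO new estimate; `maxHeartbeats 1600000` ∕ `maxRecDepth 2048` for the size of 411's terms only.  Imports BY NAME n15-c∕411 `…GradientDefectGaugedUNTwistedCross` (★★★★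
`uN_hasMaj_idef_covD_glueInv_smoothCutDressed_cross_tr`), n15-c∕412 `…PerCubeGreenTwoGridGradientKnitSmall` (`cvSmall335J`), n15-c∕339's imports (dag-n15-a `…SiteFits` ∕ `…CutRows` ∕ `…NonlocalRow`
∕ `…CommutatorOutputSupport`, n15-c∕337, Ξ-4 `…CovariantLandauFlatRowsAllKing`, `…CutRowsMargin`), n15-c `…TwoSpacingGluingCovariant` (`covD_comp_mulOp_scalar`), n15-c `…PerCubeGreenAdjointRows`
(`scPsi_near_scChi`), dag-n15-c g8 `…BackwardShift` (`kingPr_add_unitVec`); through 411: n15-c∕409 (`mulOp_comp_covD_comp_cut_of_support`, `shifted_support_fine_of_cross`).  Generator HOME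
`tools/g35/g32J/build_C5J.py` (= g32's build_C5.py on 411: 339's discharges VERBATIM + the gradient entry's).  Nothing in the tree is modified, no landed name re-declared.
THE THEOREM `uN_idef_covD_scGlued_tr`: n15-c∕339 `uN_idef_scGlued_tr` WITH `D_U = covD η Ad(U_{μ₀}) e_{μ₀}` ∕ `D_{U′} = covD η′ Ad(U′_{μ₀}) e′_{μ₀}` IN FRONT OF THE GLUED PROPAGATORS: the same
quantifier prefix and displayed gauge-group data, plus, for the direction `μ₀`, the transporter letters `Σ_j|(η⁻¹(Ad(u′_k(σx))Ad(U_{μ₀}(x))Ad(u′_k(σ(x+e_{μ₀})))ᵀ − 1))_{ij}| ≤ c_a ≤ 1` on the blocks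
of cube `k` (both grids; (3.35) in the cube gauge) and their pairing fit `o_a` there — DISPLAYED (producers: the cube's Reg335 holder, as n15-c∕371∕389 for entries 0∕3); every other row of 411
DISCHARGED BY NAME: 339's discharges verbatim; the Leibniz data by `covD_comp_mulOp_scalar` and 339's partition letters ∕ fits (`hh1′`, `hf1`, `hfh`, `hh1` + the dichotomy:
`abs_shift_fit_of_cross`); the shifted-support margins by `scPsi_near_scChi`, `scChi′ = scChi∘π` and the dichotomy; the dichotomy by `kingPr_add_unitVec`; the output plateau of the jet
piece by `scPsi_near_scChi`; the letter by n15-c∕412 at `S = (L^k)^{−1∕4} + o + s + r_D + o_a`.  Conclusion: the η-defect through `τ_{Ad∘U′}` of `D_{U′}∘scGlued′` against `D_U∘scGlued` is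
`≤ D·((L^k)^{−1∕4} + o + ((1+ρ)^{(d+1)(L^r−1)} − 1) + r_D + o_a)·e^{−(δ∕16)|y−y′|_T}` blockwise.
HONEST FRAMING ∕ LIMITS.  As n15-c∕339: bookkeeping on MODEL carriers at model level; the displayed hypotheses are the paper's small-field hypotheses in the CUBE GAUGES and the lane's `P`∕`N_V`
letters, whose producers are NOT here; constants crude and ours.  The SHAPE of the gradient entry of [B9] (3.42) ∕ Thm 3.14 for `G′`, NOT the printed theorem; nothing of [B5]∕[B6]∕[B7]∕[B9]
asserted.  NE2⁺ NOT PRINTED, NOT proved; N15 of record untouched (DISCHARGED AS CONSUMED, p687738); K3⁸ OPEN; counts of record UNMOVED (typed 28∕28 · discharged 8∕27); one finite 𝕋⁴ at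
fixed ε per index — NOT infinite volume, NOT OS on ℝ⁴, NOT a mass gap, NOT Clay.  Restate-immune (no Theses import).
-/


noncomputable section

open scoped BigOperators Matrix Matrix.Norms.Frobenius

namespace Summit.QuantumFields.YangMills.BalabanUVNodes.N15.Gluing

open Real
open Literature.MathematicalPhysics.QuantumFieldTheory.Balaban1983to89
open Literature.MathematicalPhysics.QuantumFieldTheory.Balaban1983to89.B5Prop11Plancherel (Tor fine unitVec)
open Literature.MathematicalPhysics.QuantumFieldTheory.Balaban1983to89.B11SectG (BlockNorm HasMaj RowSum hasMaj_zero)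
open Literature.MathematicalPhysics.QuantumFieldTheory.Balaban1983to89.B6RandomWalk (Triangle254)
open Literature.MathematicalPhysics.QuantumFieldTheory.Balaban1983to89.T4EtaRateDefect (idef)
open Literature.MathematicalPhysics.QuantumFieldTheory.Balaban1983to89.T4EtaRateCoeffDefect (pull)
open Literature.MathematicalPhysics.QuantumFieldTheory.Balaban1983to89.B6Prop26Gluing (mulOp mulOp_apply ind ind_nonneg ind_le_one)
open Literature.MathematicalPhysics.QuantumFieldTheory.Balaban1983to89.B6UnitTorusCarrier (unitTorusGeo triangle254_unitTorusGeo rowSum_unitTorusGeo unitTorusGeo_dist_nonneg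
  unitTorusGeo_dist_symm unitTorusGeo_dist_self)
open Literature.MathematicalPhysics.QuantumFieldTheory.Balaban1983to89.B5SiteBridgeP12 (MP)
open Literature.MathematicalPhysics.QuantumFieldTheory.King1986 (aK aK_pos aK_le)
open Literature.MathematicalPhysics.QuantumFieldTheory.King1986.Torus (blockOf tdistT tdistT_nonneg tdistT_symm)
open Literature.Barriers.QuantumFields (traceForm)
open Summit.QuantumFields.YangMills.BalabanUVNodes.N15.BackgroundLayer (fgrad fgradAdj bgrad fgrad_apply fgradAdj_apply bgrad_apply stack projO bgPropV covLapM tCoefA tCoefC unstackM)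
open Summit.QuantumFields.YangMills.BalabanUVNodes.N15.VectorPiece (bshiftEquiv bshiftEquiv_apply kingPr kingPrV tensorId tdistT_blockOf_sub_unitVec_le kingPr_add_unitVec)
open Summit.QuantumFields.YangMills.BalabanUVNodes.N15.MatrixSpecies (mmulOp coordMat liftBlk liftMap liftEquiv liftEquiv_apply liftEquiv_symm_apply covD)
open Summit.QuantumFields.YangMills.BalabanUVNodes.N15.TwoGrid (paramsOf chiCube cubeBlocks chiCube_of_not_mem abs_chiCube_le_one)
open Summit.QuantumFields.YangMills.BalabanUVNodes.N15.CurvedSpecies (gaugePair uN_hasMaj_idef_covD_glueInv_smoothCutDressed_cross_tr)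
open Summit.QuantumFields.YangMills.BalabanUVNodes.N15.CovLandau (cgrad csavg cGreen bBack flatRowsAll_king)
open Summit.QuantumFields.YangMills.BalabanUVNodes.N15.CovAvg (kingStairT kingSec ctauS blockOf_kingPr ctauS_coordMat_Ad_eq_conj abs_kingStairT_coordMat_Ad_transpose_le_one
  smear_cols_kingStairT_coordMat_Ad_transpose_sub_one_le smear_cols_kingStairT_coordMat_Ad_transpose_sub_one_le_kingPr)

variable {d : ℕ}

/-- [folklore] **THE SHIFTED PARTITION FIT ACROSS THE PAIRING**: from the fit `|h′(x′) − h(πx′)| ≤ o_o`, the coarse one-step letter `|n(h(x+e) − h(x))| ≤ c` (`n > 0`) and King's dichotomy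
`π(x′+e′) ∈ {πx′, πx′+e}`: `|h′(x′+e′) − h(πx′+e)| ≤ o_o + c∕n`. [cite: King1986, p.664 (pairing convention «x′ ∈ B^n(x)»)] -/
theorem abs_shift_fit_of_cross {X X' ι : Type} (pr : X' → X) (e : X → X) (e' : X' → X') {h : X → ℝ} {h' : X' → ℝ} {oo c n : ℝ} (hn : 0 < n)
    (hfh : ∀ p : X' × ι, |h' p.1 - h (pr p.1)| ≤ oo) (hh1 : ∀ p : X × ι, |n * (h (e p.1) - h p.1)| ≤ c)
    (hcross : ∀ x', pr (e' x') = pr x' ∨ pr (e' x') = e (pr x')) (p : X' × ι) :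
    |h' (e' p.1) - h (e (pr p.1))| ≤ oo + c / n := by
  have hc : |h (e (pr p.1)) - h (pr p.1)| ≤ c / n := by
    have h1 := hh1 (pr p.1, p.2)
    rw [abs_mul, abs_of_pos hn] at h1
    rw [le_div_iff₀ hn, mul_comm]; exact h1
  have hc0 : 0 ≤ c / n := (abs_nonneg _).trans hc
  rcases hcross p.1 with hx | hx
  · calc |h' (e' p.1) - h (e (pr p.1))| = |(h' (e' p.1) - h (pr (e' p.1))) - (h (e (pr p.1)) - h (pr p.1))| := by rw [hx]; congr 1; ring
      _ ≤ |h' (e' p.1) - h (pr (e' p.1))| + |h (e (pr p.1)) - h (pr p.1)| := abs_sub _ _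
      _ ≤ oo + c / n := add_le_add (hfh (e' p.1, p.2)) hc
  · calc |h' (e' p.1) - h (e (pr p.1))| = |h' (e' p.1) - h (pr (e' p.1))| := by rw [hx]
      _ ≤ oo + c / n := (hfh (e' p.1, p.2)).trans (le_add_of_nonneg_right hc0)

section Knit

variable {L : ℕ} [NeZero L]

set_option maxHeartbeats 1600000 in
set_option maxRecDepth 2048 in
/-- ★★★ **THE TWO-GRID η-DEFECT OF THE GRADIENT ENTRY `D_U∘G′(U)` KNIT WITH PER-CUBE GAUGES, THROUGH THE COVARIANT TRANSPORT (n15-c∕411 INSTANTIATED ON SITES)** — n15-c∕339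
`uN_idef_scGlued_tr` with the covariant derivatives of the raw fields in the direction `μ₀` in front; displayed in addition: the cube-gauge transporter letters `c_a ≤ 1` of the direction `μ₀` on
the blocks of each cube and their pairing fit `o_a`; every other row of 411 DISCHARGED BY NAME.  MODEL carriers; SHAPE of [B9] (3.42)'s gradient entry for `G′`. [cite: Balaban1985BackgroundPropagators, (3.42) p.397 (gradient entry), Thm 3.14 pp.426–427 (template), (3.34)–(3.35) p.396, (3.50) p.400, (3.62)–(3.65) pp.402–403; Balaban1985Averaging, (125) p.36;
Balaban1984PropagatorsII, (2.133)–(2.136) p.247; King1986, p.664 (pairing)] -/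
theorem uN_idef_covD_scGlued_tr (hL : Odd L ∧ 1 < L) (hL7 : 7 ≤ L) {a₀ : ℝ} (ha₀ : 0 < a₀) (ι : Type) [Fintype ι] [DecidableEq ι] (μ₀ : Fin (d + 1)) :
    ∃ δ w₀ R₀ θ₀ D : ℝ, 0 < δ ∧ 0 < R₀ ∧ 0 < θ₀ ∧ ∀ (mv kk r : ℕ), 1 ≤ kk → 1 ≤ r → w₀ ≤ ((L ^ mv : ℕ) : ℝ) → ∀ {mm : Type} [Fintype mm] [DecidableEq mm] (e : Matrix mm mm ℂ ≃L[ℝ] (ι → ℝ)), (∀ A B : Matrix mm mm ℂ, traceForm A B = e A ⬝ᵥ e B) → ∀ (u' : (Fin (d + 1) → ZMod (2 * L)) → ScX' d L mv kk r hL → Matrix mm mm ℂ), (∀ k x', (u' k x')ᴴ * u' k x' = 1) → ∀ (U : Fin (d + 1) → ScX d L mv kk hL → Matrix mm mm ℂ) (U' : Fin (d + 1) → ScX' d L mv kk r hL → Matrix mm mm ℂ), (∀ μ x', (U' μ x')ᴴ * U' μ x' = 1) → ∀ (P : (ScX d L mv kk hL × ι → ℝ) →ₗ[ℝ] (ScX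 d L mv kk hL × ι → ℝ)) (P' : (ScX' d L mv kk r hL × ι → ℝ) →ₗ[ℝ] (ScX' d L mv kk r hL × ι → ℝ)) (NV : (Fin (d + 1) → ZMod (2 * L)) → (ScX d L mv kk hL × ι → ℝ) →ₗ[ℝ] (ScX d L mv kk hL × ι → ℝ)) (NV' : (Fin (d + 1) → ZMod (2 * L)) → (ScX' d L mv kk r hL × ι → ℝ) →ₗ[ℝ] (ScX' d L mv kk r hL × ι → ℝ)) (rV RN θF rD oV oN o ρ : ℝ), 0 ≤ rV → 0 ≤ RN → 0 ≤ rD → 0 ≤ oV → 0 ≤ oN → 0 ≤ ρ → rV * (1 + Fintype.card (Fin (d + 1) ⊕ Fin (d + 1))) + RN ≤ R₀ → oV * (1 + Fintype.card (Fin (d + 1) ⊕ Fin (d + 1))) + oN ≤ o → θF ≤ θ₀ →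
        (∀ k, mmulOp (fun x => coordMat e (ContinuousLinearMap.mulLeftRight ℝ (Matrix mm mm ℂ) (u' k (kingSec (cvM d L mv kk hL) L kk r x)) (u' k (kingSec (cvM d L mv kk hL) L kk r x))ᴴ)) ∘ₗ P ∘ₗ mmulOp (fun x => (coordMat e (ContinuousLinearMap.mulLeftRight ℝ (Matrix mm mm ℂ) (u' k (kingSec (cvM d L mv kk hL) L kk r x)) (u' k (kingSec (cvM d L mv kk hL) L kk r x))ᴴ))ᵀ) = (scQQ d L mv kk hL (aK a₀ (L : ℝ) kk * (((L ^ kk : ℕ) : ℝ)) ^ (d + 1)) ι) - NV k) → (∀ k, mmulOp (fun x' => coordMat e (ContinuousLinearMap.mulLeftRight ℝ (Matrix mm mm ℂ) (u' k x') (u' k x')ᴴ)) ∘ₗ P' ∘ₗ mmulOp (fun x' => (coordMat e (ContinuousLinearMap.mulLeftRight ℝ (Matrix mm mm ℂ) (u' k x') (u' k x')ᴴ))ᵀ) = (scQQ' d L mv kk r hL (aK a₀ (L : ℝ) (r + kk) * (((L ^ r * L ^ kk : ℕ) : ℝ)) ^ (d + 1)) ι) - NV' k) → (∀ k x, scChi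 d L mv kk hL k x ≠ 0 → ∀ i, ∑ j, |tCoefC ((((L ^ kk : ℕ) : ℝ))⁻¹) (gaugePair (scShift d L mv kk hL) fun μ x => coordMat e (ContinuousLinearMap.mulLeftRight ℝ (Matrix mm mm ℂ) (u' k (kingSec (cvM d L mv kk hL) L kk r x) * U μ x * (u' k (kingSec (cvM d L mv kk hL) L kk r (scShift d L mv kk hL μ x)))ᴴ) (u' k (kingSec (cvM d L mv kk hL) L kk r x) * U μ x * (u' k (kingSec (cvM d L mv kk hL) L kk r (scShift d L mv kk hL μ x)))ᴴ)ᴴ)) x i j| ≤ rV) →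
        (∀ k j' x, scChi d L mv kk hL k x ≠ 0 → ∀ i, ∑ j, |tCoefA ((((L ^ kk : ℕ) : ℝ))⁻¹) (gaugePair (scShift d L mv kk hL) fun μ x => coordMat e (ContinuousLinearMap.mulLeftRight ℝ (Matrix mm mm ℂ) (u' k (kingSec (cvM d L mv kk hL) L kk r x) * U μ x * (u' k (kingSec (cvM d L mv kk hL) L kk r (scShift d L mv kk hL μ x)))ᴴ) (u' k (kingSec (cvM d L mv kk hL) L kk r x) * U μ x * (u' k (kingSec (cvM d L mv kk hL) L kk r (scShift d L mv kk hL μ x)))ᴴ)ᴴ)) j' x i j| ≤ rV) → (∀ k x', scChi' d L mv kk r hL k x' ≠ 0 → ∀ i, ∑ j, |tCoefC ((((L ^ r * L ^ kk : ℕ) : ℝ))⁻¹) (gaugePair (scShift' d L mv kk r hL) fun μ x' => coordMat e (ContinuousLinearMap.mulLeftRight ℝ (Matrix mm mm ℂ) (u' k x' * U' μ x' * (u' k (scShift' d L mv kk r hL μ x'))ᴴ) (u' k x' * U' μ x' * (u' k (scShift' d L mv kk r hL μ x'))ᴴ)ᴴ)) x' i j| ≤ rV) → (∀ k j' x', scChi'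 d L mv kk r hL k x' ≠ 0 → ∀ i, ∑ j, |tCoefA ((((L ^ r * L ^ kk : ℕ) : ℝ))⁻¹) (gaugePair (scShift' d L mv kk r hL) fun μ x' => coordMat e (ContinuousLinearMap.mulLeftRight ℝ (Matrix mm mm ℂ) (u' k x' * U' μ x' * (u' k (scShift' d L mv kk r hL μ x'))ᴴ) (u' k x' * U' μ x' * (u' k (scShift' d L mv kk r hL μ x'))ᴴ)ᴴ)) j' x' i j| ≤ rV) →
        (∀ k x' i, ∑ j, |(scChi' d L mv kk r hL k x' • tCoefC ((((L ^ r * L ^ kk : ℕ) : ℝ))⁻¹) (gaugePair (scShift' d L mv kk r hL) fun μ x' => coordMat e (ContinuousLinearMap.mulLeftRight ℝ (Matrix mm mm ℂ) (u' k x' * U' μ x' * (u' k (scShift' d L mv kk r hL μ x'))ᴴ) (u' k x' * U' μ x' * (u' k (scShift' d L mv kk r hL μ x'))ᴴ)ᴴ)) x') i j - (scChi d L mv kk hL k ((kingPr L kk r (cvM d L mv kk hL)) x') • tCoefC ((((L ^ kk : ℕ) : ℝ))⁻¹) (gaugePair (scShift d L mv kk hL) fun μ x => coordMat e (ContinuousLinearMap.mulLeftRight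 ℝ (Matrix mm mm ℂ) (u' k (kingSec (cvM d L mv kk hL) L kk r x) * U μ x * (u' k (kingSec (cvM d L mv kk hL) L kk r (scShift d L mv kk hL μ x)))ᴴ) (u' k (kingSec (cvM d L mv kk hL) L kk r x) * U μ x * (u' k (kingSec (cvM d L mv kk hL) L kk r (scShift d L mv kk hL μ x)))ᴴ)ᴴ)) ((kingPr L kk r (cvM d L mv kk hL)) x')) i j| ≤ oV) →
        (∀ k j' x' i, ∑ j, |(scChi' d L mv kk r hL k x' • tCoefA ((((L ^ r * L ^ kk : ℕ) : ℝ))⁻¹) (gaugePair (scShift' d L mv kk r hL) fun μ x' => coordMat e (ContinuousLinearMap.mulLeftRight ℝ (Matrix mm mm ℂ) (u' k x' * U' μ x' * (u' k (scShift' d L mv kk r hL μ x'))ᴴ) (u' k x' * U' μ x' * (u' k (scShift' d L mv kk r hL μ x'))ᴴ)ᴴ)) j' x') i j - (scChi d L mv kk hL k ((kingPr L kk r (cvM d L mv kk hL)) x') • tCoefA ((((L ^ kk : ℕ) : ℝ))⁻¹) (gaugePair (scShift d L mv kk hL) fun μ x => coordMat e (ContinuousLinearMap.mulLeftRight ℝ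 (Matrix mm mm ℂ) (u' k (kingSec (cvM d L mv kk hL) L kk r x) * U μ x * (u' k (kingSec (cvM d L mv kk hL) L kk r (scShift d L mv kk hL μ x)))ᴴ) (u' k (kingSec (cvM d L mv kk hL) L kk r x) * U μ x * (u' k (kingSec (cvM d L mv kk hL) L kk r (scShift d L mv kk hL μ x)))ᴴ)ᴴ)) j' ((kingPr L kk r (cvM d L mv kk hL)) x')) i j| ≤ oV) → (∀ k, HasMaj (ScNorm d L mv kk hL ι) (ScNorm d L mv kk hL ι) (mulOp (fun p : ScX d L mv kk hL × ι => scPsi d L mv kk hL k p.1) ∘ₗ NV k ∘ₗ mulOp (fun p : ScX d L mv kk hL × ι => scChi d L mv kk hL k p.1)) (fun y y' => RN * Real.exp (-(δ * (unitTorusGeo L kk (cvM d L mv kk hL)).dist y y')))) →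
        (∀ k, HasMaj (ScNorm' d L mv kk r hL ι) (ScNorm' d L mv kk r hL ι) (mulOp (fun p : ScX' d L mv kk r hL × ι => scPsi' d L mv kk r hL k p.1) ∘ₗ NV' k ∘ₗ mulOp (fun p : ScX' d L mv kk r hL × ι => scChi' d L mv kk r hL k p.1)) (fun y y' => RN * Real.exp (-(δ * (unitTorusGeo L kk (cvM d L mv kk hL)).dist y y')))) → (∀ k, HasMaj (ScNorm d L mv kk hL ι) (BlockNorm.ofBlocks (unitTorusGeo L kk (cvM d L mv kk hL)) (liftBlk (scBlk d L mv kk hL ∘ kingPr L kk r (cvM d L mv kk hL)) ι)) (idef (pull (liftMap (kingPr L kk r (cvM d L mv kk hL)) ι)) (pull (liftMap (kingPr L kk r (cvM d L mv kk hL)) ι)) (mulOp (fun p : ScX' d L mv kk r hL × ι => scPsi' d L mv kk r hL k p.1) ∘ₗ NV' k ∘ₗ mulOp (fun p : ScX' d L mv kk r hL × ι => scChi' d L mv kk r hL k p.1)) (mulOp (fun p : ScX d L mv kk hL × ι => scPsi d L mv kk hL k p.1) ∘ₗ NV k ∘ₗ mulOp (fun p : ScX d L mv kk hL × ι => scChi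 d L mv kk hL k p.1))) (fun y y' => oN * Real.exp (-(δ * (unitTorusGeo L kk (cvM d L mv kk hL)).dist y y')))) → (∀ k, HasMaj (ScNorm d L mv kk hL ι) (ScNorm d L mv kk hL ι) ((LinearMap.id - mulOp (fun p : ScX d L mv kk hL × ι => scPsi d L mv kk hL k p.1)) ∘ₗ NV k ∘ₗ mulOp (fun p : ScX d L mv kk hL × ι => scChi d L mv kk hL k p.1)) (fun y y' => θF * Real.exp (-(δ * (unitTorusGeo L kk (cvM d L mv kk hL)).dist y y')))) →
        (∀ k, HasMaj (ScNorm' d L mv kk r hL ι) (ScNorm' d L mv kk r hL ι) ((LinearMap.id - mulOp (fun p : ScX' d L mv kk r hL × ι => scPsi' d L mv kk r hL k p.1)) ∘ₗ NV' k ∘ₗ mulOp (fun p : ScX' d L mv kk r hL × ι => scChi' d L mv kk r hL k p.1)) (fun y y' => θF * Real.exp (-(δ * (unitTorusGeo L kk (cvM d L mv kk hL)).dist y y')))) → (∀ k, HasMaj (ScNorm d L mv kk hL ι) (BlockNorm.ofBlocks (unitTorusGeo L kk (cvM d L mv kk hL)) (liftBlk (scBlk d L mv kk hL ∘ kingPr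 L kk r (cvM d L mv kk hL)) ι)) (idef (pull (liftMap (kingPr L kk r (cvM d L mv kk hL)) ι)) (pull (liftMap (kingPr L kk r (cvM d L mv kk hL)) ι)) ((LinearMap.id - mulOp (fun p : ScX' d L mv kk r hL × ι => scPsi' d L mv kk r hL k p.1)) ∘ₗ NV' k ∘ₗ mulOp (fun p : ScX' d L mv kk r hL × ι => scChi' d L mv kk r hL k p.1)) ((LinearMap.id - mulOp (fun p : ScX d L mv kk hL × ι => scPsi d L mv kk hL k p.1)) ∘ₗ NV k ∘ₗ mulOp (fun p : ScX d L mv kk hL × ι => scChi d L mv kk hL k p.1))) (fun y y' => rD * Real.exp (-(δ * (unitTorusGeo L kk (cvM d L mv kk hL)).dist y y')))) →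
        -- the (3.35) COLUMN letter of `Ad(u′_kU′u′_kᴴ)` on the plateau cube of `k`, and the locality row of `P`
        (∀ k μ y', scBlk' d L mv kk r hL y' ∈ cvSk d L mv kk hL k → ∀ j, ∑ i, |(coordMat e (ContinuousLinearMap.mulLeftRight ℝ (Matrix mm mm ℂ) (u' k y' * U' μ y' * (u' k (y' + unitVec (fine (L ^ r * L ^ kk) (cvM d L mv kk hL)) μ))ᴴ) (u' k y' * U' μ y' * (u' k (y' + unitVec (fine (L ^ r * L ^ kk) (cvM d L mv kk hL)) μ))ᴴ)ᴴ) - 1) i j| ≤ ρ) → (∀ k, mulOp (fun p : ScX d L mv kk hL × ι => 1 - scPsi d L mv kk hL k p.1) ∘ₗ P ∘ₗ mulOp (fun p : ScX d L mv kk hL × ι => scH d L mv kk hL k p.1) = 0) →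
        -- (J) the cube-gauge transporter letters of the direction `μ₀` on the cube's blocks, both grids, and their pairing fit
        ∀ (ca oa : ℝ), 0 ≤ ca → ca ≤ 1 → 0 ≤ oa → (∀ k x, scBlk d L mv kk hL x ∈ cvSk d L mv kk hL k → ∀ i, ∑ j, |(((L ^ kk : ℕ) : ℝ) • (coordMat e (ContinuousLinearMap.mulLeftRight ℝ (Matrix mm mm ℂ) (u' k (kingSec (cvM d L mv kk hL) L kk r x)) (u' k (kingSec (cvM d L mv kk hL) L kk r x))ᴴ) * coordMat e (ContinuousLinearMap.mulLeftRight ℝ (Matrix mm mm ℂ) (U μ₀ x) (U μ₀ x)ᴴ) * (coordMat e (ContinuousLinearMap.mulLeftRight ℝ (Matrix mm mm ℂ) (u' k (kingSec (cvM d L mv kk hL) L kk r (scShift d L mv kk hL μ₀ x))) (u' k (kingSec (cvM d L mv kk hL) L kk r (scShift d L mv kk hL μ₀ x)))ᴴ))ᵀ - 1)) i j| ≤ ca) → (∀ k x', scBlk d L mv kk hL (kingPr L kk r (cvM d L mv kk hL) x') ∈ cvSk d L mv kk hL k → ∀ i, ∑ j, |(((L ^ r * L ^ kk : ℕ) : ℝ)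 • (coordMat e (ContinuousLinearMap.mulLeftRight ℝ (Matrix mm mm ℂ) (u' k x') (u' k x')ᴴ) * coordMat e (ContinuousLinearMap.mulLeftRight ℝ (Matrix mm mm ℂ) (U' μ₀ x') (U' μ₀ x')ᴴ) * (coordMat e (ContinuousLinearMap.mulLeftRight ℝ (Matrix mm mm ℂ) (u' k (scShift' d L mv kk r hL μ₀ x')) (u' k (scShift' d L mv kk r hL μ₀ x'))ᴴ))ᵀ - 1)) i j| ≤ ca) →
        (∀ k x', scBlk d L mv kk hL (kingPr L kk r (cvM d L mv kk hL) x') ∈ cvSk d L mv kk hL k → ∀ i, ∑ j, |(((L ^ r * L ^ kk : ℕ) : ℝ) • (coordMat e (ContinuousLinearMap.mulLeftRight ℝ (Matrix mm mm ℂ) (u' k x') (u' k x')ᴴ) * coordMat e (ContinuousLinearMap.mulLeftRight ℝ (Matrix mm mm ℂ) (U' μ₀ x') (U' μ₀ x')ᴴ) * (coordMat e (ContinuousLinearMap.mulLeftRight ℝ (Matrix mm mm ℂ) (u' k (scShift' d L mv kk r hL μ₀ x')) (u' k (scShift' d L mv kk r hL μ₀ x'))ᴴ))ᵀ - 1) -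 ((L ^ kk : ℕ) : ℝ) • (coordMat e (ContinuousLinearMap.mulLeftRight ℝ (Matrix mm mm ℂ) (u' k (kingSec (cvM d L mv kk hL) L kk r (kingPr L kk r (cvM d L mv kk hL) x'))) (u' k (kingSec (cvM d L mv kk hL) L kk r (kingPr L kk r (cvM d L mv kk hL) x')))ᴴ) * coordMat e (ContinuousLinearMap.mulLeftRight ℝ (Matrix mm mm ℂ) (U μ₀ (kingPr L kk r (cvM d L mv kk hL) x')) (U μ₀ (kingPr L kk r (cvM d L mv kk hL) x'))ᴴ) * (coordMat e (ContinuousLinearMap.mulLeftRight ℝ (Matrix mm mm ℂ) (u' k (kingSec (cvM d L mv kk hL) L kk r (scShift d L mv kk hL μ₀ (kingPr L kk r (cvM d L mv kk hL) x')))) (u' k (kingSec (cvM d L mv kk hL) L kk r (scShift d L mv kk hL μ₀ (kingPr L kk r (cvM d L mv kk hL) x'))))ᴴ))ᵀ - 1)) i j| ≤ oa) → HasMaj (ScNorm d L mv kk hL ι) (BlockNorm.ofBlocks (unitTorusGeo L kk (cvM d L mv kk hL)) (liftBlk (scBlk d L mv kk hL ∘ kingPr L kk r (cvM d L mv kk hL))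 ι))
          (idef (ctauS (cvM d L mv kk hL) L kk r (fun μ x' => coordMat e (ContinuousLinearMap.mulLeftRight ℝ (Matrix mm mm ℂ) (U' μ x') (U' μ x')ᴴ))) (ctauS (cvM d L mv kk hL) L kk r (fun μ x' => coordMat e (ContinuousLinearMap.mulLeftRight ℝ (Matrix mm mm ℂ) (U' μ x') (U' μ x')ᴴ))) (covD ((((L ^ r * L ^ kk : ℕ) : ℝ))⁻¹) (fun x' => coordMat e (ContinuousLinearMap.mulLeftRight ℝ (Matrix mm mm ℂ) (U' μ₀ x') (U' μ₀ x')ᴴ)) (scShift' d L mv kk r hL μ₀) ∘ₗ scGlued' d L mv kk r hL (aK a₀ (L : ℝ) (r + kk) * (((L ^ r * L ^ kk : ℕ) : ℝ)) ^ (d + 1)) ((((L ^ r * L ^ kk : ℕ) : ℝ))⁻¹) ι e u' U' P' NV') (covD ((((L ^ kk : ℕ) : ℝ))⁻¹) (fun x => coordMat e (ContinuousLinearMap.mulLeftRight ℝ (Matrix mm mm ℂ) (U μ₀ x) (U μ₀ x)ᴴ)) (scShift d L mv kk hL μ₀) ∘ₗ scGlued d L mv kk hL (aK a₀ (L : ℝ)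 kk * (((L ^ kk : ℕ) : ℝ)) ^ (d + 1)) ((((L ^ kk : ℕ) : ℝ))⁻¹) ι e (fun k x => u' k (kingSec (cvM d L mv kk hL) L kk r x)) U P NV)) (fun y y' => D * ((((L : ℝ) ^ kk) ^ (-(1 / 4 : ℝ)) + (o + (((1 + ρ) ^ ((d + 1) * (L ^ r - 1)) - 1) + rD))) + oa) * Real.exp (-(δ / 16 * (unitTorusGeo L kk (cvM d L mv kk hL)).dist y y'))) := by
  have hL2 : 2 ≤ L := (by omega); have hL3 : 3 ≤ L := (by omega); have hL4 : 4 ≤ L := (by omega); have hLpos : 0 < L := (by omega); have hL1r : (1 : ℝ) < (L : ℝ) := (by exact_mod_cast hL.2); have hL2R : (2 : ℝ) ≤ (L : ℝ) := (by exact_mod_cast hL2)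
  obtain ⟨C, δm, hC, hδm0, H⟩ := flatRowsAll_king (d := d) L hL.1 hL2 ha₀ (γ := (1 / 4 : ℝ)) (by norm_num) (by norm_num)
  let cr : ℝ := B4Sect5Proof.latticeConst (d + 1) (δm / 32); have hcr_def : cr = B4Sect5Proof.latticeConst (d + 1) (δm / 32) := rfl; have hcr0 : 0 ≤ cr := B4Sect5Proof.latticeConst_nonneg (d + 1) (by positivity); let β : ℝ := C; let β₁ : ℝ := C; let Nov : ℝ := (((2 * L) ^ (d + 1) : ℕ) : ℝ); let cι2 : ℝ := (Fintype.card ι : ℝ) ^ 2; let E' : ℝ := (Real.exp 1 * (δm / 2))⁻¹; let R : ℝ := 1 / (2 * ((β + (β₁ + π * β)) * cr * cr) + 1); have hRdef : R = 1 / (2 * ((β + (β₁ + π * β)) * cr * cr) + 1) := rfl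
  let θ₀ : ℝ := 1 / (4 * (Nov * cr * (cι2 * (2 * (β + (β₁ + π * β))) * cr)) + 4); have hθ₀def : θ₀ = 1 / (4 * (Nov * cr * (cι2 * (2 * (β + (β₁ + π * β))) * cr)) + 4) := rfl
  let A₁ : ℝ := (Fintype.card (Fin (d + 1)) : ℝ) * (32 * π ^ 2 * (2 * (β + (β₁ + π * β))) + 2 * (π * (2 * (β + (β₁ + π * β))))) +
    (π * ((d : ℝ) + 1) * 0 + 2 * (π * ((d : ℝ) + 1))) * a₀ * (2 * (β + (β₁ + π * β))) * cr
  let A₂ : ℝ := (π * ((d : ℝ) + 1) * (Real.exp 1 * (δm / 2))⁻¹ + 2 * (π * ((d : ℝ) + 1) + π * ((d : ℝ) + 1) * 1)) * R * (2 * (β + (β₁ + π * β))) * cr +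
    R * π * (2 * (β + (β₁ + π * β))) * cr
  let w₀ : ℝ := 4 * (Nov * cr * (cι2 * (A₁ + A₂ + 2 * 0))) + 2; let KRN : ℝ := (π * (d + 1) * E' + 2 * (π * (d + 1))) * (4 / 3 * a₀) + 2 * (π * (d + 1)) * (2 * a₀); have hβ0 : 0 ≤ β := hC.le; have hβ₁0 : 0 ≤ β₁ := hC.le; have hNov0 : 0 ≤ Nov := (by positivity); have hcι20 : 0 ≤ cι2 := (by positivity); have hE'0 : 0 ≤ E' := (by positivity); have hR0 : 0 < R := (by positivity); have hθ₀0 : 0 < θ₀ := (by positivity); have hA₁0 : 0 ≤ A₁ := (by positivity); have hA₂0 : 0 ≤ A₂ := (by positivity); have hKRN0 : 0 ≤ KRN := (by positivity)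
  let D335 : ℝ := ((((Nov * ((1 * (cι2 * (((β + (β₁ + (π * β))) * 2) + ((1:ℝ) * (((β + (β₁ + (π * β))) * 2) * Real.exp (δm / 8 * 1)))))) + (π * (cι2 * ((β + (β₁ + (π * β))) * 2))))) * ((2 * ((2 * (Nov * ((((cι2 * ((((((Fintype.card (Fin (d + 1)) : ℝ) * (((32 * π ^ 2) * ((β + (β₁ + (π * β))) * 2)) + (2 * (π * ((β + (β₁ + (π * β))) * 2))))) + (0:ℝ)) + ((((π * (d + 1) * 0 + 2 * (π * (d + 1))) * a₀) * ((β + (β₁ + (π * β))) * 2)) * cr)) + (((((π * (d + 1) * E' + 2 * (π * (d + 1) + π * (d + 1) * 1)) * R) * ((β + (β₁ + (π * β))) * 2)) * cr) + (((R * π) * ((β + (β₁ + (π * β))) * 2)) * cr))) + ((θ₀ * (1 * ((β + (β₁ + (π * β))) * 2))) * cr))) * ((Fintype.card ι : ℝ) * (π * (d + 1)))) + (cι2 * ((((((((Fintype.card (Fin (d + 1)) : ℝ) * ((((32 * π ^ 2) * ((((((C + ((π * (d + 1)) * β)) + (((C + ((2 * (π * (d + 1))) * β₁)) + (π * C)) +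 ((32 * π ^ 4 + π ^ 2 * (d + 1)) * β))) * cr) + ((1 * (((C + ((π * (d + 1)) * β)) +
    (((C + ((2 * (π * (d + 1))) * β₁)) + (π * C)) + ((32 * π ^ 4 + π ^ 2 * (d + 1)) * β))) * cr)) * ((R * ((β + (β₁ + (π * β))) * 2)) * cr))) + (((((β + (β₁ + (π * β))) * (1:ℝ)) * cr) * ((β + (β₁ + (π * β))) * 2)) * cr)) * 2)) + ((144 * π ^ 3 + 32 * π ^ 3 * Fintype.card (Fin (d + 1))) * ((β + (β₁ + (π * β))) * 2))) + (2 * ((π * ((((((C + ((π * (d + 1)) * β)) + (((C + ((2 * (π * (d + 1))) * β₁)) + (π * C)) + ((32 * π ^ 4 + π ^ 2 * (d + 1)) * β))) * cr) + ((1 * (((C + ((π * (d + 1)) * β)) + (((C + ((2 * (π * (d + 1))) * β₁)) + (π * C)) + ((32 * π ^ 4 + π ^ 2 * (d + 1)) * β))) * cr)) * ((R * ((β + (β₁ + (π * β))) * 2)) * cr))) + (((((β + (β₁ + (π * β))) * (1:ℝ)) * cr) * ((β + (β₁ + (π * β))) * 2)) * cr)) * 2)) + ((64 * π ^ 2 +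 π ^ 2 * Fintype.card (Fin (d + 1))) * ((β + (β₁ + (π * β))) * 2)))))) + (0:ℝ)) + (((((π * (d + 1) * 0 + 2 * (π * (d + 1))) * a₀) * ((((((C + ((π * (d + 1)) * β)) +
    (((C + ((2 * (π * (d + 1))) * β₁)) + (π * C)) + ((32 * π ^ 4 + π ^ 2 * (d + 1)) * β))) * cr) + ((1 * (((C + ((π * (d + 1)) * β)) + (((C + ((2 * (π * (d + 1))) * β₁)) + (π * C)) + ((32 * π ^ 4 + π ^ 2 * (d + 1)) * β))) * cr)) * ((R * ((β + (β₁ + (π * β))) * 2)) * cr))) + (((((β + (β₁ + (π * β))) * (1:ℝ)) * cr) * ((β + (β₁ + (π * β))) * 2)) * cr)) * 2)) * cr) + ((KRN * ((β + (β₁ + (π * β))) * 2)) * cr))) + (((((((π * (d + 1) * E' + 2 * (π * (d + 1) + π * (d + 1) * 1)) * R) * ((((((C + ((π * (d + 1)) * β)) + (((C + ((2 * (π * (d + 1))) * β₁)) + (π * C)) + ((32 * π ^ 4 + π ^ 2 * (d + 1)) * β))) * cr) + ((1 * (((C + ((π * (d + 1)) * β)) + (((C + ((2 * (π * (d + 1)))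 * β₁)) + (π * C)) + ((32 * π ^ 4 + π ^ 2 * (d + 1)) * β))) * cr)) * ((R * ((β + (β₁ + (π * β))) * 2)) * cr))) + (((((β + (β₁ + (π * β))) * (1:ℝ)) * cr) * ((β + (β₁ + (π * β))) * 2)) * cr)) * 2)) + ((((π * (d + 1) * E' + 2 * (π
    * (d + 1) + π * (d + 1) * 1)) * (1:ℝ)) + ((2 * R) * (((π * (d + 1)) + π) + π))) * ((β + (β₁ + (π * β))) * 2))) + (R * ((π * ((((((C + ((π * (d + 1)) * β)) + (((C + ((2 * (π * (d + 1))) * β₁)) + (π * C)) + ((32 * π ^ 4 + π ^ 2 * (d + 1)) * β))) * cr) + ((1 * (((C + ((π * (d + 1)) * β)) + (((C + ((2 * (π * (d + 1))) * β₁)) + (π * C)) + ((32 * π ^ 4 + π ^ 2 * (d + 1)) * β))) * cr)) * ((R * ((β + (β₁ + (π * β))) * 2)) * cr))) + (((((β + (β₁ + (π * β))) * (1:ℝ)) * cr) * ((β + (β₁ + (π * β))) * 2)) * cr)) * 2)) + ((64 * π ^ 2 + π ^ 2 * Fintype.card (Fin (d + 1))) * ((β + (β₁ + (π * β))) * 2)))))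 + (((1:ℝ) * π) * ((β + (β₁ + (π * β))) * 2))) * cr)) + (((θ₀ * ((1 * ((((((C + ((π * (d + 1)) * β)) + (((C + ((2 * (π * (d + 1))) * β₁)) + (π * C)) + ((32 * π ^ 4 + π ^ 2 * (d + 1)) * β))) * cr) + ((1 * (((C + ((π * (d + 1)) * β)) + (((C + ((2 * (π * (d + 1))) * β₁)) + (π * C)) + ((32 * π ^ 4 + π ^
    2 * (d + 1)) * β))) * cr)) * ((R * ((β + (β₁ + (π * β))) * 2)) * cr))) + (((((β + (β₁ + (π * β))) * (1:ℝ)) * cr) * ((β + (β₁ + (π * β))) * 2)) * cr)) * 2)) + ((1 * ((β + (β₁ + (π * β))) * 2)) * (π * (d + 1))))) * cr) + (((1:ℝ) * (1 * ((β + (β₁ + (π * β))) * 2))) * cr))) + ((1:ℝ) * ((((((Fintype.card (Fin (d + 1)) : ℝ) * (((32 * π ^ 2) * ((β + (β₁ + (π * β))) * 2)) + (2 * (π * ((β + (β₁ + (π * β))) * 2))))) + (0:ℝ)) + ((((π * (d + 1) * 0 + 2 * (π * (d + 1))) * a₀) * ((β + (β₁ + (π * β))) * 2)) * cr)) + (((((π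 * (d + 1) * E' + 2 * (π * (d + 1) + π * (d + 1) * 1)) * R) * ((β + (β₁ + (π * β))) * 2)) * cr) + (((R * π) * ((β + (β₁ + (π * β))) * 2)) * cr))) + ((θ₀ * (1 * ((β + (β₁ + (π * β))) * 2))) * cr)))) + ((1:ℝ) * ((((((Fintype.card (Fin (d + 1)) : ℝ) * (((32 * π ^ 2) * ((β + (β₁ + (π * β))) * 2)) + (2 * (π * ((β + (β₁ + (π * β))) * 2))))) + (0:ℝ)) + ((((π * (d + 1) * 0 + 2 * (π * (d +
    1))) * a₀) * ((β + (β₁ + (π * β))) * 2)) * cr)) + (((((π * (d + 1) * E' + 2 * (π * (d + 1) + π * (d + 1) * 1)) * R) * ((β + (β₁ + (π * β))) * 2)) * cr) + (((R * π) * ((β + (β₁ + (π * β))) * 2)) * cr))) + ((θ₀ * (1 * ((β + (β₁ + (π * β))) * 2))) * cr)))))) + (((cι2 * (((0:ℝ) * 2) + 0)) * ((Fintype.card ι : ℝ) * (π * (d + 1)))) + (cι2 * (((((((0:ℝ) * ((R * ((((((C + ((π * (d + 1)) * β)) + (((C + ((2 * (π * (d + 1))) * β₁)) + (π * C)) + ((32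 * π ^ 4 + π ^ 2 * (d + 1)) * β))) * cr) + ((1 * (((C + ((π * (d + 1)) * β)) + (((C + ((2 * (π * (d + 1))) * β₁)) + (π * C)) + ((32 * π ^ 4 + π ^ 2 * (d + 1)) * β))) * cr)) * ((R * ((β + (β₁ + (π * β))) * 2)) * cr))) + (((((β + (β₁ + (π * β))) * (1:ℝ)) * cr) * ((β + (β₁ + (π * β))) * 2)) * cr)) * 2)) + ((1:ℝ) * ((β + (β₁ + (π * β))) * 2)))) * cr) * cr) + ((0:ℝ) * (1 + (((R * ((β + (β₁ + (π * β))) * 2)) * cr) * cr)))) + ((1:ℝ) * (((0:ℝ) * 2) + 0))) +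
    ((1:ℝ) * (((0:ℝ) * 2) + 0)))))))) * cr)) * cr)) * cr) + (((Nov * (((((1 * (cι2 * (((β + (β₁ + (π * β))) * 2) + ((1:ℝ) * (((β + (β₁ + (π * β))) * 2) * Real.exp (δm / 8 * 1)))))) * ((Fintype.card ι : ℝ) * (π * (d + 1)))) + ((1 * (cι2 * ((((((((((C + ((π * (d + 1)) * β)) + (((C + ((2 * (π * (d + 1))) * β₁)) + (π * C)) + ((32 * π ^ 4 + π ^ 2 * (d + 1)) * β))) * cr) + ((1 * (((C + ((π * (d + 1)) * β)) + (((C + ((2 * (π * (d + 1))) * β₁)) + (π * C)) + ((32 * π ^ 4 + π ^ 2 * (d + 1)) * β))) * cr)) * ((R * ((β + (β₁ + (π * β))) * 2)) * cr))) + (((((β + (β₁ + (π * β))) * (1:ℝ)) * cr) * ((β + (β₁ + (π * β))) * 2)) * cr)) * 2) + ((1:ℝ) * ((((((((C + ((π * (d + 1)) * β)) + (((C + ((2 * (π * (d + 1))) * β₁)) + (π * C)) + ((32 * π ^ 4 + π ^ 2 * (d + 1)) * β))) * cr) + ((1 * (((C + ((π * (d + 1)) * β)) + (((C + ((2 * (π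 * (d + 1))) * β₁)) + (π * C)) + ((32 * π ^ 4 + π ^ 2 * (d + 1)) * β))) * cr)) *
    ((R * ((β + (β₁ + (π * β))) * 2)) * cr))) + (((((β + (β₁ + (π * β))) * (1:ℝ)) * cr) * ((β + (β₁ + (π * β))) * 2)) * cr)) * 2) * Real.exp (δm / 8 * 1)) + ((1:ℝ) * ((β + (β₁ + (π * β))) * 2))))) + ((1:ℝ) * (((β + (β₁ + (π * β))) * 2) * Real.exp (δm / 8 * 1)))) + ((1:ℝ) * (((β + (β₁ + (π * β))) * 2) + ((1:ℝ) * (((β + (β₁ + (π * β))) * 2) * Real.exp (δm / 8 * 1)))))) + ((1:ℝ) * (((β + (β₁ + (π * β))) * 2) + ((1:ℝ) * (((β + (β₁ + (π * β))) * 2) * Real.exp (δm / 8 * 1)))))))) * 1)) + ((((Fintype.card ι : ℝ) * (π * (d + 1) + π)) * (cι2 * (((β + (β₁ + (π * β))) * 2) + ((1:ℝ) * (((β + (β₁ + (π * β))) * 2) * Real.exp (δm / 8 * 1)))))) * 1)) + ((((π * (cι2 * ((β + (β₁ + (π * β))) * 2))) * ((Fintype.card ι : ℝ) * (π * (d + 1))))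 + ((π * (cι2 * ((((((((C + ((π * (d + 1)) * β)) + (((C + ((2 * (π * (d + 1))) * β₁)) + (π * C)) + ((32 * π ^ 4 + π ^ 2 * (d + 1)) * β))) * cr) + ((1 * (((C + ((π * (d +
    1)) * β)) + (((C + ((2 * (π * (d + 1))) * β₁)) + (π * C)) + ((32 * π ^ 4 + π ^ 2 * (d + 1)) * β))) * cr)) * ((R * ((β + (β₁ + (π * β))) * 2)) * cr))) + (((((β + (β₁ + (π * β))) * (1:ℝ)) * cr) * ((β + (β₁ + (π * β))) * 2)) * cr)) * 2) + ((1:ℝ) * ((β + (β₁ + (π * β))) * 2))) + ((1:ℝ) * ((β + (β₁ + (π * β))) * 2))))) * 1)) + ((((Fintype.card ι : ℝ) * (64 * π ^ 2 + π ^ 2 * Fintype.card (Fin (d + 1)))) * (cι2 * ((β + (β₁ + (π * β))) * 2))) * 1)))) * 2) * cr))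
  refine ⟨δm, w₀, R, θ₀, D335, hδm0, hR0, hθ₀0, fun mv kk r hk hr hw₀ => ?_⟩
  intro mm _ _ e he u' hu' U U' hU' P P' NV NV' rV RN θF rD oV oN o ρ hrV hRN hrD hoV hoN hρ0 hRle hole hθle
    hP hP' hCloc hAloc hCloc' hAloc' hfitC hfitA hNVcut hNVcut' hDNV hfarN hfarN' hDfarN hρ hPloc ca oa hca0 hca1 hoa0 hTa hTa' hTDa
  -- the data of the cover at `(m, k, r)`
  have hn : 1 ≤ L ^ kk := Nat.one_le_pow _ _ hLpos; have hn' : 1 ≤ L ^ r * L ^ kk := Nat.mul_pos (Nat.one_le_pow _ _ hLpos) (Nat.one_le_pow _ _ hLpos); have hW0 : 4 * (Nov * cr * (cι2 * (A₁ + A₂ + 2 * 0))) ≤ ((L ^ mv : ℕ) : ℝ) := (by linarith only [hw₀])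
  have hW2R : (2 : ℝ) ≤ ((L ^ mv : ℕ) : ℝ) := by
    have : 0 ≤ 4 * (Nov * cr * (cι2 * (A₁ + A₂ + 2 * 0))) := by positivity
    linarith only [this, hw₀]
  have hW2 : 2 ≤ L ^ mv := (by exact_mod_cast hW2R); have hw : 0 < L ^ mv := (by omega); have hW1 : (1 : ℝ) ≤ ((L ^ mv : ℕ) : ℝ) := (by linarith only [hW2R]); have hWpos : (0 : ℝ) < ((L ^ mv : ℕ) : ℝ) := (by linarith only [hW2R])
  have hW3 : 3 ≤ L ^ mv := by
    have hmv : mv ≠ 0 := by rintro rfl; simp at hW2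
    calc 3 ≤ L := hL3
      _ = L ^ 1 := (pow_one L).symm
      _ ≤ L ^ mv := Nat.pow_le_pow_right hLpos (Nat.one_le_iff_ne_zero.mpr hmv)
  have hM : ∀ ν, cvM d L mv kk hL ν = 2 * L * L ^ mv := MP_succ_eq L mv kk hL; have hMc : ∀ ν, cvM d L mv kk hL ν = 2 * L ^ (mv + 1) := fun ν => rfl; have hlo : (2 : ℝ) * ((L ^ mv : ℕ) : ℝ) ≤ ((2 * L ^ mv : ℕ) : ℝ) := (by push_cast; exact le_rfl); have hhi : ((2 * L ^ mv : ℕ) : ℝ) + ((L ^ mv : ℕ) : ℝ) + (2 + 1) * ((L ^ mv : ℕ) : ℝ) + 1 ≤ ((6 * L ^ mv + 1 : ℕ) : ℝ) := (by push_cast; linarith only [])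
  have hS6 : 6 * L ^ mv + 1 ≤ 2 * L * L ^ mv := by
    have h7 : 7 * L ^ mv ≤ L * L ^ mv := Nat.mul_le_mul_right _ hL7
    have e7 : 2 * L * L ^ mv = 2 * (L * L ^ mv) := by ring
    rw [e7]; omega
  have hm₁ : 2 * L ^ mv ≤ coverMargin L mv := two_mul_le_coverMargin hL7 mv; have hfitI : coverMargin L mv - 2 * L ^ mv + (6 * L ^ mv + 1) ≤ L * L ^ mv := coverMargin_inner_fit hL7 hW2; have hfit0 := coverMargin_fit hL3 mv; have hfit : coverMargin L mv + 2 * L ^ mv + 1 ≤ L * L ^ mv := (by omega); have hS0 : L * L ^ mv ≤ 2 * L * L ^ mv := (by rw [mul_assoc]; omega); have hmg₂ : 2 * L ^ mv + 1 ≤ coverMargin L mv := (coverMargin_cut_margin hL7 hW3).1; have hfg₂ : coverMargin L mv - 2 * L ^ mv + (6 * L ^ mv + 1) + 1 ≤ L * L ^ mv := (coverMargin_cut_margin hL7 hW3).2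
  have h3 : 3 ≤ L ^ kk * L ^ mv :=
    calc 3 ≤ L ^ mv := hW3
      _ = 1 * L ^ mv := (one_mul _).symm
      _ ≤ L ^ kk * L ^ mv := Nat.mul_le_mul_right _ hn
  have hK0 : 0 < 2 * L := (by omega); have hK2 : 2 ≤ 2 * L := (by omega); have hLr : 0 < L ^ r := pow_pos hLpos r; let η : ℝ := (((L ^ kk : ℕ) : ℝ))⁻¹; let η' : ℝ := (((L ^ r * L ^ kk : ℕ) : ℝ))⁻¹; let W : ℝ := ((L ^ mv : ℕ) : ℝ); have hWdef : W = ((L ^ mv : ℕ) : ℝ) := rfl; have hηinv : η⁻¹ = ((L ^ kk : ℕ) : ℝ) := inv_inv _; have hη'inv : η'⁻¹ = ((L ^ r * L ^ kk : ℕ) : ℝ) := inv_inv _; have hnr : (0 : ℝ) < ((L ^ kk : ℕ) : ℝ) := (by exact_mod_cast hn); have hnr' : (0 : ℝ) < ((L ^ r * L ^ kk : ℕ) : ℝ) := (by exact_mod_cast hn')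
  have hη0 : 0 ≤ η := inv_nonneg.mpr hnr.le; have hη'0 : 0 ≤ η' := inv_nonneg.mpr hnr'.le; have hnR : (1 : ℝ) ≤ ((L ^ kk : ℕ) : ℝ) := (by exact_mod_cast hn); have hnn' : ((L ^ kk : ℕ) : ℝ) ≤ ((L ^ r * L ^ kk : ℕ) : ℝ) := (by exact_mod_cast Nat.le_mul_of_pos_left _ hLr)
  -- the site coordinates' steps and the partition letters, both grids (n15-c∕262∕263)
  have hξS := scXi_shift_lift ι hM hw (d := d) (L := L) (mv := mv) (kk := kk) (hL := hL); have hξS' := scXi'_shift_lift ι hM hw (d := d) (L := L) (mv := mv) (kk := kk) (r := r) (hL := hL); have hs0c : (0 : ℝ) ≤ ((((L ^ kk : ℕ) : ℝ)) * ((L ^ mv : ℕ) : ℝ))⁻¹ := (by positivity); have hs1c : ((((L ^ kk : ℕ) : ℝ)) * ((L ^ mv : ℕ) : ℝ))⁻¹ ≤ 1 := inv_le_one_of_one_le₀ (one_le_mul_of_one_le_of_one_le (by exact_mod_cast hn) hW1)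
  have hs0f : (0 : ℝ) ≤ ((((L ^ r * L ^ kk : ℕ) : ℝ)) * ((L ^ mv : ℕ) : ℝ))⁻¹ := (by positivity); have hs1f : ((((L ^ r * L ^ kk : ℕ) : ℝ)) * ((L ^ mv : ℕ) : ℝ))⁻¹ ≤ 1 := inv_le_one_of_one_le₀ (one_le_mul_of_one_le_of_one_le (by exact_mod_cast hn') hW1)
  have hsW : |((L ^ kk : ℕ) : ℝ)| * (π * |((((L ^ kk : ℕ) : ℝ)) * ((L ^ mv : ℕ) : ℝ))⁻¹|) = π / W := by
    rw [abs_of_pos hnr, abs_of_nonneg hs0c, mul_inv, hWdef]; field_simp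
  have hsW2 : ((L ^ kk : ℕ) : ℝ) ^ 2 * (32 * π ^ 2 * (((((L ^ kk : ℕ) : ℝ)) * ((L ^ mv : ℕ) : ℝ))⁻¹) ^ 2) = 32 * π ^ 2 / W ^ 2 := by
    rw [mul_inv, hWdef]; field_simp
  have hsW' : |((L ^ r * L ^ kk : ℕ) : ℝ)| * (π * |((((L ^ r * L ^ kk : ℕ) : ℝ)) * ((L ^ mv : ℕ) : ℝ))⁻¹|) = π / W := by
    rw [abs_of_pos hnr', abs_of_nonneg hs0f, mul_inv, hWdef]; field_simp
  have hsW2' : ((L ^ r * L ^ kk : ℕ) : ℝ) ^ 2 * (32 * π ^ 2 * (((((L ^ r * L ^ kk : ℕ) : ℝ)) * ((L ^ mv : ℕ) : ℝ))⁻¹) ^ 2) = 32 * π ^ 2 / W ^ 2 := by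
    rw [mul_inv, hWdef]; field_simp
  -- King's window and the flat rows at the masses `a_K(a₀, L, k)·n^{d+1}`, `a_K(a₀, L, r+k)·n′^{d+1}` (Ξ-4 rows 1–12)
  have haK : 0 < aK a₀ (L : ℝ) kk := aK_pos ha₀ hL1r hk; have haKle : aK a₀ (L : ℝ) kk ≤ a₀ := aK_le ha₀ hL1r hk; have ha' : 0 < aK a₀ (L : ℝ) kk * (((L ^ kk : ℕ) : ℝ)) ^ (d + 1) := (by positivity); have haK' : 0 < aK a₀ (L : ℝ) (r + kk) := aK_pos ha₀ hL1r (hk.trans (Nat.le_add_left kk r)); have haKle' : aK a₀ (L : ℝ) (r + kk) ≤ a₀ := aK_le ha₀ hL1r (hk.trans (Nat.le_add_left kk r)); have ha'' : 0 < aK a₀ (L : ℝ) (r + kk) * (((L ^ r * L ^ kk : ℕ) : ℝ)) ^ (d + 1) := (by positivity)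
  have haKabs : |aK a₀ (L : ℝ) kk| + |aK a₀ (L : ℝ) (r + kk)| ≤ 2 * a₀ := by rw [abs_of_pos haK, abs_of_pos haK']; linarith only [haKle, haKle']
  have hcNle : |aK a₀ (L : ℝ) kk * (((L ^ kk : ℕ) : ℝ)) ^ (d + 1)| * ((((L ^ kk : ℕ) : ℝ)) ^ (d + 1))⁻¹ * (2 * (π * (d + 1) / (L ^ mv : ℕ))) ≤ (π * (d + 1) / W * 0 + 2 * (π * (d + 1) / W)) * a₀ := by
    rw [abs_of_pos ha', mul_assoc (aK a₀ (L : ℝ) kk), mul_inv_cancel₀ (by positivity), mul_one, mul_zero, zero_add, mul_comm]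
    exact mul_le_mul_of_nonneg_left haKle (by positivity)
  have hcNle' : |aK a₀ (L : ℝ) (r + kk) * (((L ^ r * L ^ kk : ℕ) : ℝ)) ^ (d + 1)| * ((((L ^ r * L ^ kk : ℕ) : ℝ)) ^ (d + 1))⁻¹ * (2 * (π * (d + 1) / (L ^ mv : ℕ))) ≤ (π * (d + 1) / W * 0 + 2 * (π * (d + 1) / W)) * a₀ := by
    rw [abs_of_pos ha'', mul_assoc (aK a₀ (L : ℝ) (r + kk)), mul_inv_cancel₀ (by positivity), mul_one, mul_zero, zero_add, mul_comm]
    exact mul_le_mul_of_nonneg_left haKle' (by positivity)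
  obtain ⟨hG0, hGF, -, hGB, hG0', hGF', -, hGB', hDG, hDGF, -, hDGB⟩ := H kk hk r hr (mv + 1) (cvM d L mv kk hL) hMc ι
  -- the two-grid letter `(L^k)^{−1∕4}` and the size `S`
  let εk : ℝ := ((L : ℝ) ^ kk) ^ (-(1 / 4 : ℝ)); have hLk1 : (1 : ℝ) ≤ (L : ℝ) ^ kk := (by rw [← Nat.cast_pow]; exact hnR); have hεk0 : 0 ≤ εk := Real.rpow_nonneg (by positivity) _
  have hnε : (((L ^ kk : ℕ) : ℝ))⁻¹ ≤ εk := by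
    rw [Nat.cast_pow, ← Real.rpow_neg_one]; exact Real.rpow_le_rpow_of_exponent_le hLk1 (by norm_num)
  have hw1 : W⁻¹ ≤ 1 := inv_le_one_of_one_le₀ hW1
  have hnwε : ((((L ^ kk : ℕ) : ℝ)) * W)⁻¹ ≤ εk :=
    calc ((((L ^ kk : ℕ) : ℝ)) * W)⁻¹ = (((L ^ kk : ℕ) : ℝ))⁻¹ * W⁻¹ := by rw [mul_inv]
      _ ≤ (((L ^ kk : ℕ) : ℝ))⁻¹ * 1 := mul_le_mul_of_nonneg_left hw1 (by positivity)
      _ ≤ εk := by rw [mul_one]; exact hnε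
  have hn'ε : (((L ^ r * L ^ kk : ℕ) : ℝ))⁻¹ ≤ εk := (inv_anti₀ hnr hnn').trans hnε; let sS : ℝ := (1 + ρ) ^ ((d + 1) * (L ^ r - 1)) - 1; have hsS0 : 0 ≤ sS := (by have h1 := one_le_pow₀ (M₀ := ℝ) (a := 1 + ρ) (by linarith only [hρ0]) (n := (d + 1) * (L ^ r - 1)); show 0 ≤ (1 + ρ) ^ ((d + 1) * (L ^ r - 1)) - 1; linarith only [h1]); let Sdef : ℝ := εk + (o + (sS + rD)) + oa; have ho0 : 0 ≤ o := le_trans (by positivity) hole; have hεS : εk ≤ Sdef := (by show εk ≤ εk + (o + (sS + rD)) + oa; linarith only [ho0, hsS0, hrD, hoa0])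
  -- the two-grid letters of the cover
  let O1 : ℝ := |W⁻¹| * (((L ^ kk : ℕ) : ℝ) * W)⁻¹ * (64 * π ^ 2 + π ^ 2 * Fintype.card (Fin (d + 1))); let O2 : ℝ := W⁻¹ ^ 2 * (((L ^ kk : ℕ) : ℝ) * W)⁻¹ * (144 * π ^ 3 + 32 * π ^ 3 * Fintype.card (Fin (d + 1)))
  let RNK : ℝ := (π * (d + 1) / (L ^ mv : ℕ) * (Real.exp 1 * (δm / 2))⁻¹ + 2 * (π * (d + 1) / (L ^ mv : ℕ))) * (4 / 3 * a₀ * ((L : ℝ) ^ kk) ^ (-(1 / 4 : ℝ))) +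
    2 * (π * (d + 1) / (((L ^ kk : ℕ) : ℝ) * (L ^ mv : ℕ))) * (|aK a₀ (L : ℝ) kk| + |aK a₀ (L : ℝ) (r + kk)|)
  have hoχ0 : 0 ≤ π * (d + 1) / (((L ^ kk : ℕ) : ℝ) * W) := div_nonneg (by positivity) (mul_nonneg hnr.le hWpos.le); have hoχ₂0 : 0 ≤ (W)⁻¹ * (((L ^ kk : ℕ) : ℝ) * W)⁻¹ * (32 * π ^ 4 + π ^ 2 * (d + 1)) := mul_nonneg (mul_nonneg (inv_nonneg.mpr hWpos.le) (inv_nonneg.mpr (mul_nonneg hnr.le hWpos.le))) (by positivity); have ho₁0 : 0 ≤ O1 := mul_nonneg (mul_nonneg (abs_nonneg _) (inv_nonneg.mpr (mul_nonneg hnr.le hWpos.le))) (by positivity); have ho₂0 : 0 ≤ O2 := mul_nonneg (mul_nonneg (pow_nonneg (inv_nonneg.mpr hWpos.le) 2) (inv_nonneg.mpr (mul_nonneg hnr.le hWpos.le))) (by positivity)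
  have hRNK0 : 0 ≤ RNK := (by positivity); have hℓ1 : π * (d + 1) / W ≤ π * (d + 1) := div_le_self (by positivity) hW1; have hLRb : π * (d + 1) / W * (Real.exp 1 * (δm / 2))⁻¹ + 2 * (π * (d + 1) / W) ≤ π * (d + 1) * E' + 2 * (π * (d + 1)) := add_le_add (mul_le_mul_of_nonneg_right hℓ1 hE'0) (by linarith only [hℓ1]); have hLR20 : 0 ≤ π * (d + 1) / W * (Real.exp 1 * (δm / 2))⁻¹ + 2 * (π * (d + 1) / W + π * (d + 1) / W * 1) := (by positivity)
  have hLRb2 : π * (d + 1) / W * (Real.exp 1 * (δm / 2))⁻¹ + 2 * (π * (d + 1) / W + π * (d + 1) / W * 1) ≤ π * (d + 1) * E' + 2 * (π * (d + 1) + π * (d + 1) * 1) := add_le_add (mul_le_mul_of_nonneg_right hℓ1 hE'0) (by linarith only [hℓ1]); have hcNb : (π * (d + 1) / W * 0 + 2 * (π * (d + 1) / W)) * a₀ ≤ (π * (d + 1) * 0 + 2 * (π * (d + 1))) * a₀ := mul_le_mul_of_nonneg_right (by linarith only [hℓ1]) ha₀.le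
  -- the windows of the cut box about the partition cell, radius 2, both grids
  have hwin2 : ∀ (μ : Fin (d + 1)) (k : Fin (d + 1) → ZMod (2 * L)) (p : ScX d L mv kk hL × ι), (∃ p₀ : ScX d L mv kk hL × ι, (p₀ = p ∨ p₀ = (fun μ => liftEquiv (scShift d L mv kk hL μ) ι) μ p ∨ p₀ = ((fun μ => liftEquiv (scShift d L mv kk hL μ) ι) μ).symm p) ∧ ∀ ν, |cenRep (2 * L) ((fun ν (p : ScX d L mv kk hL × ι) => scXi d L mv kk hL ν p.1) ν p₀ - ((k ν).val : ℝ))| < 2 + 1) → (fun p : ScX d L mv kk hL × ι => scChi d L mv kk hL k p.1) p = 1 := fun μ k p hp => scChi_lift_eq_one_of_near_bbox 2 ι hM hw hlo hhi hS6 μ k p hp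
  have hwin : ∀ (μ : Fin (d + 1)) (k : Fin (d + 1) → ZMod (2 * L)) (p : ScX d L mv kk hL × ι), (∃ p₀ : ScX d L mv kk hL × ι, (p₀ = p ∨ p₀ = (fun μ => liftEquiv (scShift d L mv kk hL μ) ι) μ p ∨ p₀ = ((fun μ => liftEquiv (scShift d L mv kk hL μ) ι) μ).symm p) ∧ ∀ ν, |cenRep (2 * L) ((fun ν (p : ScX d L mv kk hL × ι) => scXi d L mv kk hL ν p.1) ν p₀ - ((k ν).val : ℝ))| < 1) → (fun p : ScX d L mv kk hL × ι => scChi d L mv kk hL k p.1) p = 1 := fun μ k => hcubeWindow_of_bumpWindow (2 * L) (fun ν (p : ScX d L mv kk hL × ι) => scXi d L mv kk hL ν p.1) 2 (fun μ => liftEquiv (scShift d L mv kk hL μ) ι) μ (by norm_num) (hwin2 μ k)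
  have hwin2' : ∀ (μ : Fin (d + 1)) (k : Fin (d + 1) → ZMod (2 * L)) (p : ScX' d L mv kk r hL × ι), (∃ p₀ : ScX' d L mv kk r hL × ι, (p₀ = p ∨ p₀ = (fun μ => liftEquiv (scShift' d L mv kk r hL μ) ι) μ p ∨ p₀ = ((fun μ => liftEquiv (scShift' d L mv kk r hL μ) ι) μ).symm p) ∧ ∀ ν, |cenRep (2 * L) ((fun ν (p : ScX' d L mv kk r hL × ι) => scXi' d L mv kk r hL ν p.1) ν p₀ - ((k ν).val : ℝ))| < 2 + 1) → (fun p : ScX' d L mv kk r hL × ι => scChi' d L mv kk r hL k p.1) p = 1 := fun μ k p hp => scChi'_lift_eq_one_of_near_bbox 2 ι hM hw hlo hhi hS6 μ k p hp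
  have hwin' : ∀ (μ : Fin (d + 1)) (k : Fin (d + 1) → ZMod (2 * L)) (p : ScX' d L mv kk r hL × ι), (∃ p₀ : ScX' d L mv kk r hL × ι, (p₀ = p ∨ p₀ = (fun μ => liftEquiv (scShift' d L mv kk r hL μ) ι) μ p ∨ p₀ = ((fun μ => liftEquiv (scShift' d L mv kk r hL μ) ι) μ).symm p) ∧ ∀ ν, |cenRep (2 * L) ((fun ν (p : ScX' d L mv kk r hL × ι) => scXi' d L mv kk r hL ν p.1) ν p₀ - ((k ν).val : ℝ))| < 1) → (fun p : ScX' d L mv kk r hL × ι => scChi' d L mv kk r hL k p.1) p = 1 := fun μ k => hcubeWindow_of_bumpWindow (2 * L) (fun ν (p : ScX' d L mv kk r hL × ι) => scXi' d L mv kk r hL ν p.1) 2 (fun μ => liftEquiv (scShift' d L mv kk r hL μ) ι) μ (by norm_num) (hwin2' μ k)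
  -- the smallness (n15-c∕119 §3, as in n15-c∕262)
  have hq₀ : (β + (β₁ + π / W * β)) * (R * cr) * cr ≤ 1 / 2 := by
    have hπw : π / W ≤ π := div_le_self pi_pos.le hW1
    have h1 : (β + (β₁ + π / W * β)) * (R * cr) * cr ≤ (β + (β₁ + π * β)) * (R * cr) * cr := by
      have := mul_le_mul_of_nonneg_right hπw hβ0
      exact mul_le_mul_of_nonneg_right (mul_le_mul_of_nonneg_right (by linarith only [this]) (by positivity)) hcr0
    have h2 : (β + (β₁ + π * β)) * (R * cr) * cr = ((β + (β₁ + π * β)) * cr * cr) / (2 * ((β + (β₁ + π * β)) * cr * cr) + 1) := by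
      rw [hRdef]; ring
    have h3' : ((β + (β₁ + π * β)) * cr * cr) / (2 * ((β + (β₁ + π * β)) * cr * cr) + 1) ≤ 1 / 2 := by
      rw [div_le_iff₀ (by positivity)]
      have : 0 ≤ (β + (β₁ + π * β)) * cr * cr := by positivity
      linarith only [this]
    linarith only [h1, h2, h3']
  have hθsm : Nov * cr * (cι2 * (θ₀ * (2 * (β + (β₁ + π * β))) * cr)) ≤ 1 / 4 := by
    have hX : 0 ≤ Nov * cr * (cι2 * (2 * (β + (β₁ + π * β))) * cr) := by positivity
    have e1 : Nov * cr * (cι2 * (θ₀ * (2 * (β + (β₁ + π * β))) * cr)) = θ₀ * (Nov * cr * (cι2 * (2 * (β + (β₁ + π * β))) * cr)) := by ring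
    rw [e1, hθ₀def, div_mul_eq_mul_div, one_mul, div_le_iff₀ (by positivity)]
    linarith only [hX]
  have hsmall := cvSmall (Nov := Nov) (cr := cr) (cι2 := cι2) (cJ := (Fintype.card (Fin (d + 1)) : ℝ)) (β := β) (β₁ := β₁) (w := W) (R := R) (θF := θ₀) (ε₀ := 0)
    (ε := δm / 2) (E' := 0) (cN₀ := a₀) (D := (d : ℝ) + 1) (κ := 0)
    hNov0 hcr0 (by positivity) (by positivity) hβ0 hβ₁0 hW1 hR0.le hθ₀0.le (by positivity) le_rfl ha₀.le (by positivity) le_rfl hq₀ hθsm (by rw [zero_div]) hW0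
  have hhalf := cvSmallHalf (Nov := Nov) (cr := cr) (cι2 := cι2) (cJ := (Fintype.card (Fin (d + 1)) : ℝ)) (β := β) (β₁ := β₁) (w := W) (R := R) (θF := θ₀) (ε₀ := 0)
    (ε := δm / 2) (E' := 0) (cN₀ := a₀) (D := (d : ℝ) + 1) (κ := 0)
    hNov0 hcr0 (by positivity) (by positivity) hβ0 hβ₁0 hW1 hR0.le hθ₀0.le (by positivity) le_rfl ha₀.le (by positivity) le_rfl hq₀ hθsm (by rw [zero_div]) hW0
  -- the `κ·S` bounds of the two-grid letters
  have hsoχ : π * (d + 1) / (((L ^ kk : ℕ) : ℝ) * W) ≤ π * (d + 1) * Sdef := by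
    rw [div_eq_mul_inv]; exact mul_le_mul_of_nonneg_left (hnwε.trans hεS) (by positivity)
  have hsoχ₁ : 2 * (π * (d + 1) / (((L ^ kk : ℕ) : ℝ) * W)) ≤ 2 * (π * (d + 1)) * Sdef := by
    rw [mul_assoc]; exact mul_le_mul_of_nonneg_left hsoχ zero_le_two
  have hsoχ₂ : (W)⁻¹ * (((L ^ kk : ℕ) : ℝ) * W)⁻¹ * (32 * π ^ 4 + π ^ 2 * (d + 1)) ≤ (32 * π ^ 4 + π ^ 2 * (d + 1)) * Sdef :=
    calc (W)⁻¹ * (((L ^ kk : ℕ) : ℝ) * W)⁻¹ * (32 * π ^ 4 + π ^ 2 * (d + 1)) ≤ 1 * Sdef * (32 * π ^ 4 + π ^ 2 * (d + 1)) := mul_le_mul_of_nonneg_right (mul_le_mul hw1 (hnwε.trans hεS) (inv_nonneg.mpr (mul_nonneg hnr.le hWpos.le)) zero_le_one) (by positivity)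
      _ = (32 * π ^ 4 + π ^ 2 * (d + 1)) * Sdef := by ring
  have hwabs : |W⁻¹| ≤ 1 := by rw [abs_of_nonneg (inv_nonneg.mpr hWpos.le)]; exact hw1
  have hso₁ : O1 ≤ (64 * π ^ 2 + π ^ 2 * Fintype.card (Fin (d + 1))) * Sdef :=
    calc O1 ≤ 1 * Sdef * (64 * π ^ 2 + π ^ 2 * Fintype.card (Fin (d + 1))) := mul_le_mul_of_nonneg_right (mul_le_mul hwabs (hnwε.trans hεS) (inv_nonneg.mpr (mul_nonneg hnr.le hWpos.le)) zero_le_one) (by positivity)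
      _ = (64 * π ^ 2 + π ^ 2 * Fintype.card (Fin (d + 1))) * Sdef := by ring
  have hso₂ : O2 ≤ (144 * π ^ 3 + 32 * π ^ 3 * Fintype.card (Fin (d + 1))) * Sdef :=
    calc O2 ≤ 1 * Sdef * (144 * π ^ 3 + 32 * π ^ 3 * Fintype.card (Fin (d + 1))) := mul_le_mul_of_nonneg_right (mul_le_mul (pow_le_one₀ (inv_nonneg.mpr hWpos.le) hw1) (hnwε.trans hεS) (inv_nonneg.mpr (mul_nonneg hnr.le hWpos.le)) zero_le_one) (by positivity)
      _ = (144 * π ^ 3 + 32 * π ^ 3 * Fintype.card (Fin (d + 1))) * Sdef := by ring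
  have hso : o ≤ 1 * Sdef := (by show o ≤ 1 * (εk + (o + (sS + rD)) + oa); linarith only [hεk0, hsS0, hrD, hoa0]); have hsoa : oa ≤ 1 * Sdef := (by show oa ≤ 1 * (εk + (o + (sS + rD)) + oa); linarith only [hεk0, hsS0, hrD, ho0]); have hsη : η ≤ 1 * Sdef := (by rw [one_mul]; exact hnε.trans hεS); have hss : sS ≤ 1 * Sdef := (by show sS ≤ 1 * (εk + (o + (sS + rD)) + oa); linarith only [hεk0, ho0, hrD, hoa0]); have hsrD : rD ≤ 1 * Sdef := (by show rD ≤ 1 * (εk + (o + (sS + rD)) + oa); linarith only [hεk0, ho0, hsS0, hoa0]); have hsm₀ : C * εk ≤ C * Sdef := mul_le_mul_of_nonneg_left hεS hC.le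
  have hsRN : RNK ≤ KRN * Sdef := by
    have h1 : (π * (d + 1) / (L ^ mv : ℕ) * (Real.exp 1 * (δm / 2))⁻¹ + 2 * (π * (d + 1) / (L ^ mv : ℕ))) * (4 / 3 * a₀ * ((L : ℝ) ^ kk) ^ (-(1 / 4 : ℝ))) ≤ (π * (d + 1) * E' + 2 * (π * (d + 1))) * (4 / 3 * a₀ * Sdef) := mul_le_mul hLRb (mul_le_mul_of_nonneg_left hεS (by positivity)) (by positivity) (by positivity)
    have h2 : 2 * (π * (d + 1) / (((L ^ kk : ℕ) : ℝ) * (L ^ mv : ℕ))) * (|aK a₀ (L : ℝ) kk| + |aK a₀ (L : ℝ) (r + kk)|) ≤ 2 * (π * (d + 1) * Sdef) * (2 * a₀) := mul_le_mul (mul_le_mul_of_nonneg_left hsoχ zero_le_two) haKabs (by positivity) (by positivity)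
    calc RNK ≤ (π * (d + 1) * E' + 2 * (π * (d + 1))) * (4 / 3 * a₀ * Sdef) + 2 * (π * (d + 1) * Sdef) * (2 * a₀) := add_le_add h1 h2
      _ = ((π * (d + 1) * E' + 2 * (π * (d + 1))) * (4 / 3 * a₀) + 2 * (π * (d + 1)) * (2 * a₀)) * Sdef := by ring
  have hsDη0 : (π / W) / η⁻¹ ≤ π * Sdef := by
    rw [hηinv, div_eq_mul_inv]; exact mul_le_mul (div_le_self pi_pos.le hW1) (hnε.trans hεS) (inv_nonneg.mpr hnr.le) pi_pos.le
  have hsDη1 : (π / W) / η'⁻¹ ≤ π * Sdef := by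
    rw [hη'inv, div_eq_mul_inv]; exact mul_le_mul (div_le_self pi_pos.le hW1) (hn'ε.trans hεS) (inv_nonneg.mpr hnr'.le) pi_pos.le
  have hsDη0J : (π / W) / ((((L ^ kk : ℕ) : ℝ))⁻¹)⁻¹ ≤ π * Sdef := by
    rw [inv_inv, div_eq_mul_inv]; exact mul_le_mul (div_le_self pi_pos.le hW1) (hnε.trans hεS) (inv_nonneg.mpr hnr.le) pi_pos.le
  have hos0 : 0 ≤ π * (d + 1) / (((L ^ kk : ℕ) : ℝ) * W) + (π / W) / ((((L ^ kk : ℕ) : ℝ))⁻¹)⁻¹ := add_nonneg hoχ0 (div_nonneg (div_nonneg pi_pos.le hWpos.le) (inv_nonneg.mpr (inv_nonneg.mpr hnr.le))); have hsos : π * (d + 1) / (((L ^ kk : ℕ) : ℝ) * W) + (π / W) / ((((L ^ kk : ℕ) : ℝ))⁻¹)⁻¹ ≤ (π * (d + 1) + π) * Sdef := (add_le_add hsoχ hsDη0J).trans_eq (by ring)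
  -- the nonnegativity of the two-grid cut kernel, the fine block map read through the pairing, the partition's support inside the box
  have hKc : ∀ (y y' : Tor (cvM d L mv kk hL)), 0 ≤ C * ((L : ℝ) ^ kk) ^ (-(1 / 4 : ℝ)) * Real.exp (-(δm * tdistT (cvM d L mv kk hL) y y')) := fun y y' => mul_nonneg (mul_nonneg hC.le hεk0) (Real.exp_nonneg _); have hblk' : liftBlk (scBlk' d L mv kk r hL) ι = liftBlk (scBlk d L mv kk hL ∘ kingPr L kk r (cvM d L mv kk hL)) ι := funext fun p => (blockOf_kingPr (cvM d L mv kk hL) L kk r p.1).symm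
  have hhχ : ∀ (k : Fin (d + 1) → ZMod (2 * L)) (x : ScX d L mv kk hL), scH d L mv kk hL k x ≠ 0 → scChi d L mv kk hL k x ≠ 0 := fun k x hx => by
    have h := chiCube_box_eq_one_of_coverH_ne_zero (n := L ^ kk) hM hw hS6 0 k (x := (x, (0 : Fin (d + 1)))) (Or.inl rfl) hx
    rw [show scChi d L mv kk hL k x = chiCube (cvM d L mv kk hL) (L ^ kk) (coverCorner (cvM d L mv kk hL) (L ^ mv) L (2 * L ^ mv) k) (6 * L ^ mv + 1) (x, 0) from rfl, h]
    exact one_ne_zero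
  -- 335's rows at the cover, by name
  have hrow : RowSum (unitTorusGeo L kk (cvM d L mv kk hL)) (δm / 32) cr := (by rw [hcr_def]; exact rowSum_unitTorusGeo L kk _ (by positivity)); have hdχt : ∀ k, ∀ μ p, |fgrad η⁻¹ (liftEquiv (scShift d L mv kk hL μ) ι) (fun p : ScX d L mv kk hL × ι => (scBump d L mv kk hL k) p.1) p| ≤ (π / W) := (by rw [hηinv]; exact fun k μ p => (abs_fgrad_bcube_le (2 * L) (fun ν (p : ScX d L mv kk hL × ι) => scXi d L mv kk hL ν p.1) 2 (fun μ => liftEquiv (scShift d L mv kk hL μ) ι) hK0 hξS _ k μ p).trans hsW.le)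
  have hdχtb : ∀ k, ∀ μ p, |bgrad η⁻¹ (liftEquiv (scShift d L mv kk hL μ) ι) (fun p : ScX d L mv kk hL × ι => (scBump d L mv kk hL k) p.1) p| ≤ (π / W) := by rw [hηinv]; exact fun k μ p => (abs_bgrad_bcube_le (2 * L) (fun ν (p : ScX d L mv kk hL × ι) => scXi d L mv kk hL ν p.1) 2 (fun μ => liftEquiv (scShift d L mv kk hL μ) ι) hK0 hξS _ k μ p).trans hsW.le
  have hsub : ∀ k, mulOp (fun p : ScX d L mv kk hL × ι => (scBump d L mv kk hL k) p.1) ∘ₗ mulOp (fun p : ScX d L mv kk hL × ι => (scChi d L mv kk hL k) p.1) = mulOp (fun p : ScX d L mv kk hL × ι => (scBump d L mv kk hL k) p.1) := fun k => bcube_cut (2 * L) (fun ν (p : ScX d L mv kk hL × ι) => scXi d L mv kk hL ν p.1) 2 (fun μ => liftEquiv (scShift d L mv kk hL μ) ι) 0 (hwin2 0 k)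
  have hχ : ∀ k, mulOp (fun p : ScX d L mv kk hL × ι => (scChi d L mv kk hL k) p.1) ∘ₗ mulOp (fun p : ScX d L mv kk hL × ι => (scBump d L mv kk hL k) p.1) = mulOp (fun p : ScX d L mv kk hL × ι => (scBump d L mv kk hL k) p.1) := fun k => cut_bcube (2 * L) (fun ν (p : ScX d L mv kk hL × ι) => scXi d L mv kk hL ν p.1) 2 (fun μ => liftEquiv (scShift d L mv kk hL μ) ι) 0 (hwin2 0 k)
  have hs : ∀ k, ∀ μ, mulOp ((fun p : ScX d L mv kk hL × ι => (scBump d L mv kk hL k) p.1) ∘ (liftEquiv (scShift d L mv kk hL μ) ι)) ∘ₗ mulOp (fun p : ScX d L mv kk hL × ι => (scChi d L mv kk hL k) p.1) = mulOp ((fun p : ScX d L mv kk hL × ι => (scBump d L mv kk hL k) p.1) ∘ (liftEquiv (scShift d L mv kk hL μ) ι)) := fun k μ => bcube_comp_shift_cut (2 * L) (fun ν (p : ScX d L mv kk hL × ι) => scXi d L mv kk hL ν p.1) 2 (fun μ => liftEquiv (scShift d L mv kk hL μ) ι) μ (hwin2 μ k)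
  have hsb : ∀ k, ∀ μ, mulOp ((fun p : ScX d L mv kk hL × ι => (scBump d L mv kk hL k) p.1) ∘ (liftEquiv (scShift d L mv kk hL μ) ι).symm) ∘ₗ mulOp (fun p : ScX d L mv kk hL × ι => (scChi d L mv kk hL k) p.1) = mulOp ((fun p : ScX d L mv kk hL × ι => (scBump d L mv kk hL k) p.1) ∘ (liftEquiv (scShift d L mv kk hL μ) ι).symm) := fun k μ => bcube_comp_shift_symm_cut (2 * L) (fun ν (p : ScX d L mv kk hL × ι) => scXi d L mv kk hL ν p.1) 2 (fun μ => liftEquiv (scShift d L mv kk hL μ) ι) μ (hwin2 μ k)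
  have hdd : ∀ k, ∀ μ, mulOp (fgrad η⁻¹ (liftEquiv (scShift d L mv kk hL μ) ι) (fun p : ScX d L mv kk hL × ι => (scBump d L mv kk hL k) p.1)) ∘ₗ mulOp (fun p : ScX d L mv kk hL × ι => (scChi d L mv kk hL k) p.1) = mulOp (fgrad η⁻¹ (liftEquiv (scShift d L mv kk hL μ) ι) (fun p : ScX d L mv kk hL × ι => (scBump d L mv kk hL k) p.1)) := fun k μ => fgrad_bcube_cut (2 * L) (fun ν (p : ScX d L mv kk hL × ι) => scXi d L mv kk hL ν p.1) 2 (fun μ => liftEquiv (scShift d L mv kk hL μ) ι) μ η⁻¹ (hwin2 μ k)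
  have hddb : ∀ k, ∀ μ, mulOp (bgrad η⁻¹ (liftEquiv (scShift d L mv kk hL μ) ι) (fun p : ScX d L mv kk hL × ι => (scBump d L mv kk hL k) p.1)) ∘ₗ mulOp (fun p : ScX d L mv kk hL × ι => (scChi d L mv kk hL k) p.1) = mulOp (bgrad η⁻¹ (liftEquiv (scShift d L mv kk hL μ) ι) (fun p : ScX d L mv kk hL × ι => (scBump d L mv kk hL k) p.1)) := fun k μ => bgrad_bcube_cut (2 * L) (fun ν (p : ScX d L mv kk hL × ι) => scXi d L mv kk hL ν p.1) 2 (fun μ => liftEquiv (scShift d L mv kk hL μ) ι) μ η⁻¹ (hwin2 μ k)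
  have hNψ : ∀ k, (scCube d L mv kk hL (aK a₀ (L : ℝ) kk * (((L ^ kk : ℕ) : ℝ)) ^ (d + 1)) ι k) ∘ₗ mulOp (fun p : ScX d L mv kk hL × ι => (scPsi d L mv kk hL k) p.1) = (scCube d L mv kk hL (aK a₀ (L : ℝ) kk * (((L ^ kk : ℕ) : ℝ)) ^ (d + 1)) ι k) := fun k => scCube_comp_mulOp_scPsi ι _ k
  have hdχt' : ∀ k, ∀ μ p', |fgrad η'⁻¹ (liftEquiv (scShift' d L mv kk r hL μ) ι) (fun p' : ScX' d L mv kk r hL × ι => (scBump' d L mv kk r hL k) p'.1) p'| ≤ (π / W) := by rw [hη'inv]; exact fun k μ p => (abs_fgrad_bcube_le (2 * L) (fun ν (p : ScX' d L mv kk r hL × ι) => scXi' d L mv kk r hL ν p.1) 2 (fun μ => liftEquiv (scShift' d L mv kk r hL μ) ι) hK0 hξS' _ k μ p).trans hsW'.le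
  have hdχtb' : ∀ k, ∀ μ p', |bgrad η'⁻¹ (liftEquiv (scShift' d L mv kk r hL μ) ι) (fun p' : ScX' d L mv kk r hL × ι => (scBump' d L mv kk r hL k) p'.1) p'| ≤ (π / W) := by rw [hη'inv]; exact fun k μ p => (abs_bgrad_bcube_le (2 * L) (fun ν (p : ScX' d L mv kk r hL × ι) => scXi' d L mv kk r hL ν p.1) 2 (fun μ => liftEquiv (scShift' d L mv kk r hL μ) ι) hK0 hξS' _ k μ p).trans hsW'.le
  have hsub' : ∀ k, mulOp (fun p : ScX' d L mv kk r hL × ι => (scBump' d L mv kk r hL k) p.1) ∘ₗ mulOp (fun p : ScX' d L mv kk r hL × ι => (scChi' d L mv kk r hL k) p.1) = mulOp (fun p : ScX' d L mv kk r hL × ι => (scBump' d L mv kk r hL k) p.1) := fun k => bcube_cut (2 * L) (fun ν (p : ScX' d L mv kk r hL × ι) => scXi' d L mv kk r hL ν p.1) 2 (fun μ => liftEquiv (scShift' d L mv kk r hL μ) ι) 0 (hwin2' 0 k)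
  have hχ' : ∀ k, mulOp (fun p : ScX' d L mv kk r hL × ι => (scChi' d L mv kk r hL k) p.1) ∘ₗ mulOp (fun p : ScX' d L mv kk r hL × ι => (scBump' d L mv kk r hL k) p.1) = mulOp (fun p : ScX' d L mv kk r hL × ι => (scBump' d L mv kk r hL k) p.1) := fun k => cut_bcube (2 * L) (fun ν (p : ScX' d L mv kk r hL × ι) => scXi' d L mv kk r hL ν p.1) 2 (fun μ => liftEquiv (scShift' d L mv kk r hL μ) ι) 0 (hwin2' 0 k)
  have hs' : ∀ k, ∀ μ, mulOp ((fun p' : ScX' d L mv kk r hL × ι => (scBump' d L mv kk r hL k) p'.1) ∘ (liftEquiv (scShift' d L mv kk r hL μ) ι)) ∘ₗ mulOp (fun p' : ScX' d L mv kk r hL × ι => (scChi' d L mv kk r hL k) p'.1) = mulOp ((fun p' : ScX' d L mv kk r hL × ι => (scBump' d L mv kk r hL k) p'.1) ∘ (liftEquiv (scShift' d L mv kk r hL μ) ι)) := fun k μ => bcube_comp_shift_cut (2 * L) (fun ν (p : ScX' d L mv kk r hL × ι) => scXi' d L mv kk r hL ν p.1) 2 (fun μ => liftEquiv (scShift' d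 L mv kk r hL μ) ι) μ (hwin2' μ k)
  have hsb' : ∀ k, ∀ μ, mulOp ((fun p' : ScX' d L mv kk r hL × ι => (scBump' d L mv kk r hL k) p'.1) ∘ (liftEquiv (scShift' d L mv kk r hL μ) ι).symm) ∘ₗ mulOp (fun p' : ScX' d L mv kk r hL × ι => (scChi' d L mv kk r hL k) p'.1) = mulOp ((fun p' : ScX' d L mv kk r hL × ι => (scBump' d L mv kk r hL k) p'.1) ∘ (liftEquiv (scShift' d L mv kk r hL μ) ι).symm) := fun k μ => bcube_comp_shift_symm_cut (2 * L) (fun ν (p : ScX' d L mv kk r hL × ι) => scXi' d L mv kk r hL ν p.1) 2 (fun μ => liftEquiv (scShift' d L mv kk r hL μ) ι) μ (hwin2' μ k)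
  have hdd' : ∀ k, ∀ μ, mulOp (fgrad η'⁻¹ (liftEquiv (scShift' d L mv kk r hL μ) ι) (fun p' : ScX' d L mv kk r hL × ι => (scBump' d L mv kk r hL k) p'.1)) ∘ₗ mulOp (fun p' : ScX' d L mv kk r hL × ι => (scChi' d L mv kk r hL k) p'.1) = mulOp (fgrad η'⁻¹ (liftEquiv (scShift' d L mv kk r hL μ) ι) (fun p' : ScX' d L mv kk r hL × ι => (scBump' d L mv kk r hL k) p'.1)) := fun k μ => fgrad_bcube_cut (2 * L) (fun ν (p : ScX' d L mv kk r hL × ι) => scXi' d L mv kk r hL ν p.1) 2 (fun μ => liftEquiv (scShift' d L mv kk r hL μ) ι) μ η'⁻¹ (hwin2' μ k)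
  have hddb' : ∀ k, ∀ μ, mulOp (bgrad η'⁻¹ (liftEquiv (scShift' d L mv kk r hL μ) ι) (fun p' : ScX' d L mv kk r hL × ι => (scBump' d L mv kk r hL k) p'.1)) ∘ₗ mulOp (fun p' : ScX' d L mv kk r hL × ι => (scChi' d L mv kk r hL k) p'.1) = mulOp (bgrad η'⁻¹ (liftEquiv (scShift' d L mv kk r hL μ) ι) (fun p' : ScX' d L mv kk r hL × ι => (scBump' d L mv kk r hL k) p'.1)) := fun k μ => bgrad_bcube_cut (2 * L) (fun ν (p : ScX' d L mv kk r hL × ι) => scXi' d L mv kk r hL ν p.1) 2 (fun μ => liftEquiv (scShift' d L mv kk r hL μ) ι) μ η'⁻¹ (hwin2' μ k)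
  have hNψ' : ∀ k, (scCube' d L mv kk r hL (aK a₀ (L : ℝ) (r + kk) * (((L ^ r * L ^ kk : ℕ) : ℝ)) ^ (d + 1)) ι k) ∘ₗ mulOp (fun p : ScX' d L mv kk r hL × ι => (scPsi' d L mv kk r hL k) p.1) = (scCube' d L mv kk r hL (aK a₀ (L : ℝ) (r + kk) * (((L ^ r * L ^ kk : ℕ) : ℝ)) ^ (d + 1)) ι k) := fun k => scCube'_comp_mulOp_scPsi' ι _ k; have hfitχ : ∀ k, ∀ x', |(scBump' d L mv kk r hL k) x' - (scBump d L mv kk hL k) ((kingPr L kk r (cvM d L mv kk hL)) x')| ≤ (π * (d + 1) / (((L ^ kk : ℕ) : ℝ) * W)) := fun k x' => abs_scBump'_sub_scBump_kingPr_le hM hw k x'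
  have hfit₁ : ∀ k, ∀ μ p', |((fun p' : ScX' d L mv kk r hL × ι => (scBump' d L mv kk r hL k) p'.1) ∘ (liftEquiv (scShift' d L mv kk r hL μ) ι)) p' - ((fun p : ScX d L mv kk hL × ι => (scBump d L mv kk hL k) p.1) ∘ (liftEquiv (scShift d L mv kk hL μ) ι)) (liftMap (kingPr L kk r (cvM d L mv kk hL)) ι p')| ≤ (2 * (π * (d + 1) / (((L ^ kk : ℕ) : ℝ) * W))) := fun k μ p' => abs_scBump'_scShift'_sub_le ι hM hw k μ p'
  have hfit₁b : ∀ k, ∀ μ p', |((fun p' : ScX' d L mv kk r hL × ι => (scBump' d L mv kk r hL k) p'.1) ∘ (liftEquiv (scShift' d L mv kk r hL μ) ι).symm) p' - ((fun p : ScX d L mv kk hL × ι => (scBump d L mv kk hL k) p.1) ∘ (liftEquiv (scShift d L mv kk hL μ) ι).symm) (liftMap (kingPr L kk r (cvM d L mv kk hL)) ι p')| ≤ (2 * (π * (d + 1) / (((L ^ kk : ℕ) : ℝ) * W))) := fun k μ p' => abs_scBump'_scShift'_symm_sub_le ι hM hw k μ p'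
  have hfit₂ : ∀ k, ∀ μ p', |fgrad η'⁻¹ (liftEquiv (scShift' d L mv kk r hL μ) ι) (fun p' : ScX' d L mv kk r hL × ι => (scBump' d L mv kk r hL k) p'.1) p' - fgrad η⁻¹ (liftEquiv (scShift d L mv kk hL μ) ι) (fun p : ScX d L mv kk hL × ι => (scBump d L mv kk hL k) p.1) (liftMap (kingPr L kk r (cvM d L mv kk hL)) ι p')| ≤ ((W)⁻¹ * (((L ^ kk : ℕ) : ℝ) * W)⁻¹ * (32 * π ^ 4 + π ^ 2 * (d + 1))) := by rw [hηinv, hη'inv]; exact fun k μ p' => abs_fgrad_scBump'_sub_le ι hM hw hL4 k μ p'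
  have hfit₂b : ∀ k, ∀ μ p', |bgrad η'⁻¹ (liftEquiv (scShift' d L mv kk r hL μ) ι) (fun p' : ScX' d L mv kk r hL × ι => (scBump' d L mv kk r hL k) p'.1) p' - bgrad η⁻¹ (liftEquiv (scShift d L mv kk hL μ) ι) (fun p : ScX d L mv kk hL × ι => (scBump d L mv kk hL k) p.1) (liftMap (kingPr L kk r (cvM d L mv kk hL)) ι p')| ≤ ((W)⁻¹ * (((L ^ kk : ℕ) : ℝ) * W)⁻¹ * (32 * π ^ 4 + π ^ 2 * (d + 1))) := by rw [hηinv, hη'inv]; exact fun k μ p' => abs_bgrad_scBump'_sub_le ι hM hw hL4 k μ p'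
  have hcut : ∀ k, HasMaj (ScNorm d L mv kk hL ι) (ScNorm d L mv kk hL ι) (mulOp (fun p : ScX d L mv kk hL × ι => (scChi d L mv kk hL k) p.1) ∘ₗ (scCube d L mv kk hL (aK a₀ (L : ℝ) kk * (((L ^ kk : ℕ) : ℝ)) ^ (d + 1)) ι k)) (fun y y' => ind (g := unitTorusGeo L kk (cvM d L mv kk hL)) (cvSk d L mv kk hL k) y * ind (g := unitTorusGeo L kk (cvM d L mv kk hL)) (cvSk d L mv kk hL k) y' * (β * Real.exp (-(δm * (unitTorusGeo L kk (cvM d L mv kk hL)).dist y y')))) := fun k => hasMaj_cut_scCube ι hM hm₁ hfitI hS0 hC.le hG0 k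
  have hcutF : ∀ k, ∀ μ, HasMaj (ScNorm d L mv kk hL ι) (ScNorm d L mv kk hL ι) (mulOp (fun p : ScX d L mv kk hL × ι => (scChi d L mv kk hL k) p.1) ∘ₗ (fgrad η⁻¹ (liftEquiv (scShift d L mv kk hL μ) ι) ∘ₗ (scCube d L mv kk hL (aK a₀ (L : ℝ) kk * (((L ^ kk : ℕ) : ℝ)) ^ (d + 1)) ι k))) (fun y y' => ind (g := unitTorusGeo L kk (cvM d L mv kk hL)) (cvSk d L mv kk hL k) y * ind (g := unitTorusGeo L kk (cvM d L mv kk hL)) (cvSk d L mv kk hL k) y' * (β₁ * Real.exp (-(δm * (unitTorusGeo L kk (cvM d L mv kk hL)).dist y y')))) := fun k μ => hasMaj_cutF_scCube ι hM hm₁ hfitI hS0 hC μ hGF k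
  have hcutB : ∀ k, ∀ μ, HasMaj (ScNorm d L mv kk hL ι) (ScNorm d L mv kk hL ι) (mulOp (fun p : ScX d L mv kk hL × ι => (scChi d L mv kk hL k) p.1) ∘ₗ (bgrad η⁻¹ (liftEquiv (scShift d L mv kk hL μ) ι) ∘ₗ (scCube d L mv kk hL (aK a₀ (L : ℝ) kk * (((L ^ kk : ℕ) : ℝ)) ^ (d + 1)) ι k))) (fun y y' => ind (g := unitTorusGeo L kk (cvM d L mv kk hL)) (cvSk d L mv kk hL k) y * ind (g := unitTorusGeo L kk (cvM d L mv kk hL)) (cvSk d L mv kk hL k) y' * (β₁ * Real.exp (-(δm * (unitTorusGeo L kk (cvM d L mv kk hL)).dist y y')))) := fun k μ => hasMaj_cutB_scCube ι hM hm₁ hfitI hS0 hC μ hGB k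
  have hcut' : ∀ k, HasMaj (BlockNorm.ofBlocks (unitTorusGeo L kk (cvM d L mv kk hL)) (liftBlk (scBlk d L mv kk hL ∘ kingPr L kk r (cvM d L mv kk hL)) ι)) (BlockNorm.ofBlocks (unitTorusGeo L kk (cvM d L mv kk hL)) (liftBlk (scBlk d L mv kk hL ∘ kingPr L kk r (cvM d L mv kk hL)) ι)) (mulOp (fun p : ScX' d L mv kk r hL × ι => (scChi' d L mv kk r hL k) p.1) ∘ₗ (scCube' d L mv kk r hL (aK a₀ (L : ℝ) (r + kk) * (((L ^ r * L ^ kk : ℕ) : ℝ)) ^ (d + 1)) ι k)) (fun y y' => ind (g := unitTorusGeo L kk (cvM d L mv kk hL)) (cvSk d L mv kk hL k) y * ind (g := unitTorusGeo L kk (cvM d L mv kk hL)) (cvSk d L mv kk hL k) y' * (β * Real.exp (-(δm * (unitTorusGeo L kk (cvM d L mv kk hL)).dist y y')))) := fun k => hasMaj_src_tgt_congr hblk' (hasMaj_cut_scCube' ι hM hm₁ hfitI hS0 hC.le hG0' k)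
  have hcutF' : ∀ k, ∀ μ, HasMaj (BlockNorm.ofBlocks (unitTorusGeo L kk (cvM d L mv kk hL)) (liftBlk (scBlk d L mv kk hL ∘ kingPr L kk r (cvM d L mv kk hL)) ι)) (BlockNorm.ofBlocks (unitTorusGeo L kk (cvM d L mv kk hL)) (liftBlk (scBlk d L mv kk hL ∘ kingPr L kk r (cvM d L mv kk hL)) ι)) (mulOp (fun p : ScX' d L mv kk r hL × ι => (scChi' d L mv kk r hL k) p.1) ∘ₗ (fgrad η'⁻¹ (liftEquiv (scShift' d L mv kk r hL μ) ι) ∘ₗ (scCube' d L mv kk r hL (aK a₀ (L : ℝ) (r + kk) * (((L ^ r * L ^ kk : ℕ) : ℝ)) ^ (d + 1)) ι k))) (fun y y' => ind (g := unitTorusGeo L kk (cvM d L mv kk hL)) (cvSk d L mv kk hL k) y * ind (g := unitTorusGeo L kk (cvM d L mv kk hL)) (cvSk d L mv kk hL k) y' * (β₁ * Real.exp (-(δm * (unitTorusGeo L kk (cvM d L mv kk hL)).dist y y')))) := fun k μ => hasMaj_src_tgt_congr hblk' (hasMaj_cutF_scCube' ι hM hm₁ hfitI hS0 hC μ hGF'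 k)
  have hcutB' : ∀ k, ∀ μ, HasMaj (BlockNorm.ofBlocks (unitTorusGeo L kk (cvM d L mv kk hL)) (liftBlk (scBlk d L mv kk hL ∘ kingPr L kk r (cvM d L mv kk hL)) ι)) (BlockNorm.ofBlocks (unitTorusGeo L kk (cvM d L mv kk hL)) (liftBlk (scBlk d L mv kk hL ∘ kingPr L kk r (cvM d L mv kk hL)) ι)) (mulOp (fun p : ScX' d L mv kk r hL × ι => (scChi' d L mv kk r hL k) p.1) ∘ₗ (bgrad η'⁻¹ (liftEquiv (scShift' d L mv kk r hL μ) ι) ∘ₗ (scCube' d L mv kk r hL (aK a₀ (L : ℝ) (r + kk) * (((L ^ r * L ^ kk : ℕ) : ℝ)) ^ (d + 1)) ι k))) (fun y y' => ind (g := unitTorusGeo L kk (cvM d L mv kk hL)) (cvSk d L mv kk hL k) y * ind (g := unitTorusGeo L kk (cvM d L mv kk hL)) (cvSk d L mv kk hL k) y' * (β₁ * Real.exp (-(δm * (unitTorusGeo L kk (cvM d L mv kk hL)).dist y y')))) := fun k μ => hasMaj_src_tgt_congr hblk' (hasMaj_cutB_scCube' ι hM hm₁ hfitI hS0 hC μ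 hGB' k)
  have hDcut : ∀ k, HasMaj (ScNorm d L mv kk hL ι) (BlockNorm.ofBlocks (unitTorusGeo L kk (cvM d L mv kk hL)) (liftBlk (scBlk d L mv kk hL) ι ∘ liftMap (kingPr L kk r (cvM d L mv kk hL)) ι)) (idef (pull (liftMap (kingPr L kk r (cvM d L mv kk hL)) ι)) (pull (liftMap (kingPr L kk r (cvM d L mv kk hL)) ι)) (mulOp (fun p : ScX' d L mv kk r hL × ι => (scChi' d L mv kk r hL k) p.1) ∘ₗ (scCube' d L mv kk r hL (aK a₀ (L : ℝ) (r + kk) * (((L ^ r * L ^ kk : ℕ) : ℝ)) ^ (d + 1)) ι k)) (mulOp (fun p : ScX d L mv kk hL × ι => (scChi d L mv kk hL k) p.1) ∘ₗ (scCube d L mv kk hL (aK a₀ (L : ℝ) kk * (((L ^ kk : ℕ) : ℝ)) ^ (d + 1)) ι k))) (fun y y' => ind (g := unitTorusGeo L kk (cvM d L mv kk hL)) (cvSk d L mv kk hL k) y * ind (g := unitTorusGeo L kk (cvM d L mv kk hL)) (cvSk d L mv kk hL k) y' * ((C * εk) * Real.exp (-(δm * (unitTorusGeo L kk (cvM d L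 mv kk hL)).dist y y')))) := fun k => hasMaj_idef_cut_scCube ι hM hm₁ hfitI hS0 hKc hDG k
  have hDcutF : ∀ k, ∀ μ, HasMaj (ScNorm d L mv kk hL ι) (BlockNorm.ofBlocks (unitTorusGeo L kk (cvM d L mv kk hL)) (liftBlk (scBlk d L mv kk hL) ι ∘ liftMap (kingPr L kk r (cvM d L mv kk hL)) ι)) (idef (pull (liftMap (kingPr L kk r (cvM d L mv kk hL)) ι)) (pull (liftMap (kingPr L kk r (cvM d L mv kk hL)) ι)) (mulOp (fun p : ScX' d L mv kk r hL × ι => (scChi' d L mv kk r hL k) p.1) ∘ₗ (fgrad η'⁻¹ (liftEquiv (scShift' d L mv kk r hL μ) ι) ∘ₗ (scCube' d L mv kk r hL (aK a₀ (L : ℝ) (r + kk) * (((L ^ r * L ^ kk : ℕ) : ℝ)) ^ (d + 1)) ι k))) (mulOp (fun p : ScX d L mv kk hL × ι => (scChi d L mv kk hL k) p.1) ∘ₗ (fgrad η⁻¹ (liftEquiv (scShift d L mv kk hL μ) ι) ∘ₗ (scCube d L mv kk hL (aK a₀ (L : ℝ) kk * (((L ^ kk : ℕ) : ℝ)) ^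 (d + 1)) ι k)))) (fun y y' => ind (g := unitTorusGeo L kk (cvM d L mv kk hL)) (cvSk d L mv kk hL k) y * ind (g := unitTorusGeo L kk (cvM d L mv kk hL)) (cvSk d L mv kk hL k) y' * ((C * εk) * Real.exp (-(δm * (unitTorusGeo L kk (cvM d L mv kk hL)).dist y y')))) := fun k μ => hasMaj_idef_cutF_scCube ι hM hm₁ hfitI hS0 hKc μ hDGF k
  have hDcutB : ∀ k, ∀ μ, HasMaj (ScNorm d L mv kk hL ι) (BlockNorm.ofBlocks (unitTorusGeo L kk (cvM d L mv kk hL)) (liftBlk (scBlk d L mv kk hL) ι ∘ liftMap (kingPr L kk r (cvM d L mv kk hL)) ι)) (idef (pull (liftMap (kingPr L kk r (cvM d L mv kk hL)) ι)) (pull (liftMap (kingPr L kk r (cvM d L mv kk hL)) ι)) (mulOp (fun p : ScX' d L mv kk r hL × ι => (scChi' d L mv kk r hL k) p.1) ∘ₗ (bgrad η'⁻¹ (liftEquiv (scShift' d L mv kk r hL μ) ι) ∘ₗ (scCube' d L mv kk r hL (aK a₀ (L : ℝ) (r + kk) * (((L ^ r * L ^ kk : ℕ) : ℝ)) ^ (d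 + 1)) ι k))) (mulOp (fun p : ScX d L mv kk hL × ι => (scChi d L mv kk hL k) p.1) ∘ₗ (bgrad η⁻¹ (liftEquiv (scShift d L mv kk hL μ) ι) ∘ₗ (scCube d L mv kk hL (aK a₀ (L : ℝ) kk * (((L ^ kk : ℕ) : ℝ)) ^ (d + 1)) ι k)))) (fun y y' => ind (g := unitTorusGeo L kk (cvM d L mv kk hL)) (cvSk d L mv kk hL k) y * ind (g := unitTorusGeo L kk (cvM d L mv kk hL)) (cvSk d L mv kk hL k) y' * ((C * εk) * Real.exp (-(δm * (unitTorusGeo L kk (cvM d L mv kk hL)).dist y y')))) := fun k μ => hasMaj_idef_cutB_scCube ι hM hm₁ hfitI hS0 hKc μ hDGB k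
  have hs2 : ∀ k, ∀ μ, mulOp (fun p : ScX d L mv kk hL × ι => (scChi d L mv kk hL k) p.1) ∘ₗ mulOp ((fun p : ScX d L mv kk hL × ι => (scBump d L mv kk hL k) p.1) ∘ (liftEquiv (scShift d L mv kk hL μ) ι)) = mulOp ((fun p : ScX d L mv kk hL × ι => (scBump d L mv kk hL k) p.1) ∘ (liftEquiv (scShift d L mv kk hL μ) ι)) := fun k μ => cut_bcube_comp_shift (2 * L) (fun ν (p : ScX d L mv kk hL × ι) => scXi d L mv kk hL ν p.1) 2 (fun μ => liftEquiv (scShift d L mv kk hL μ) ι) μ (hwin2 μ k)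
  have hsb2 : ∀ k, ∀ μ, mulOp (fun p : ScX d L mv kk hL × ι => (scChi d L mv kk hL k) p.1) ∘ₗ mulOp ((fun p : ScX d L mv kk hL × ι => (scBump d L mv kk hL k) p.1) ∘ (liftEquiv (scShift d L mv kk hL μ) ι).symm) = mulOp ((fun p : ScX d L mv kk hL × ι => (scBump d L mv kk hL k) p.1) ∘ (liftEquiv (scShift d L mv kk hL μ) ι).symm) := fun k μ => cut_bcube_comp_shift_symm (2 * L) (fun ν (p : ScX d L mv kk hL × ι) => scXi d L mv kk hL ν p.1) 2 (fun μ => liftEquiv (scShift d L mv kk hL μ) ι) μ (hwin2 μ k)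
  have hdd2 : ∀ k, ∀ μ, mulOp (fun p : ScX d L mv kk hL × ι => (scChi d L mv kk hL k) p.1) ∘ₗ mulOp (fgrad η⁻¹ (liftEquiv (scShift d L mv kk hL μ) ι) (fun p : ScX d L mv kk hL × ι => (scBump d L mv kk hL k) p.1)) = mulOp (fgrad η⁻¹ (liftEquiv (scShift d L mv kk hL μ) ι) (fun p : ScX d L mv kk hL × ι => (scBump d L mv kk hL k) p.1)) := fun k μ => cut_fgrad_bcube (2 * L) (fun ν (p : ScX d L mv kk hL × ι) => scXi d L mv kk hL ν p.1) 2 (fun μ => liftEquiv (scShift d L mv kk hL μ) ι) μ η⁻¹ (hwin2 μ k)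
  have hddb2 : ∀ k, ∀ μ, mulOp (fun p : ScX d L mv kk hL × ι => (scChi d L mv kk hL k) p.1) ∘ₗ mulOp (bgrad η⁻¹ (liftEquiv (scShift d L mv kk hL μ) ι) (fun p : ScX d L mv kk hL × ι => (scBump d L mv kk hL k) p.1)) = mulOp (bgrad η⁻¹ (liftEquiv (scShift d L mv kk hL μ) ι) (fun p : ScX d L mv kk hL × ι => (scBump d L mv kk hL k) p.1)) := fun k μ => cut_bgrad_bcube (2 * L) (fun ν (p : ScX d L mv kk hL × ι) => scXi d L mv kk hL ν p.1) 2 (fun μ => liftEquiv (scShift d L mv kk hL μ) ι) μ η⁻¹ (hwin2 μ k)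
  have hs2' : ∀ k, ∀ μ, mulOp (fun p' : ScX' d L mv kk r hL × ι => (scChi' d L mv kk r hL k) p'.1) ∘ₗ mulOp ((fun p' : ScX' d L mv kk r hL × ι => (scBump' d L mv kk r hL k) p'.1) ∘ (liftEquiv (scShift' d L mv kk r hL μ) ι)) = mulOp ((fun p' : ScX' d L mv kk r hL × ι => (scBump' d L mv kk r hL k) p'.1) ∘ (liftEquiv (scShift' d L mv kk r hL μ) ι)) := fun k μ => cut_bcube_comp_shift (2 * L) (fun ν (p : ScX' d L mv kk r hL × ι) => scXi' d L mv kk r hL ν p.1) 2 (fun μ => liftEquiv (scShift' d L mv kk r hL μ) ι) μ (hwin2' μ k)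
  have hsb2' : ∀ k, ∀ μ, mulOp (fun p' : ScX' d L mv kk r hL × ι => (scChi' d L mv kk r hL k) p'.1) ∘ₗ mulOp ((fun p' : ScX' d L mv kk r hL × ι => (scBump' d L mv kk r hL k) p'.1) ∘ (liftEquiv (scShift' d L mv kk r hL μ) ι).symm) = mulOp ((fun p' : ScX' d L mv kk r hL × ι => (scBump' d L mv kk r hL k) p'.1) ∘ (liftEquiv (scShift' d L mv kk r hL μ) ι).symm) := fun k μ => cut_bcube_comp_shift_symm (2 * L) (fun ν (p : ScX' d L mv kk r hL × ι) => scXi' d L mv kk r hL ν p.1) 2 (fun μ => liftEquiv (scShift' d L mv kk r hL μ) ι) μ (hwin2' μ k)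
  have hdd2' : ∀ k, ∀ μ, mulOp (fun p' : ScX' d L mv kk r hL × ι => (scChi' d L mv kk r hL k) p'.1) ∘ₗ mulOp (fgrad η'⁻¹ (liftEquiv (scShift' d L mv kk r hL μ) ι) (fun p' : ScX' d L mv kk r hL × ι => (scBump' d L mv kk r hL k) p'.1)) = mulOp (fgrad η'⁻¹ (liftEquiv (scShift' d L mv kk r hL μ) ι) (fun p' : ScX' d L mv kk r hL × ι => (scBump' d L mv kk r hL k) p'.1)) := fun k μ => cut_fgrad_bcube (2 * L) (fun ν (p : ScX' d L mv kk r hL × ι) => scXi' d L mv kk r hL ν p.1) 2 (fun μ => liftEquiv (scShift' d L mv kk r hL μ) ι) μ η'⁻¹ (hwin2' μ k)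
  have hddb2' : ∀ k, ∀ μ, mulOp (fun p' : ScX' d L mv kk r hL × ι => (scChi' d L mv kk r hL k) p'.1) ∘ₗ mulOp (bgrad η'⁻¹ (liftEquiv (scShift' d L mv kk r hL μ) ι) (fun p' : ScX' d L mv kk r hL × ι => (scBump' d L mv kk r hL k) p'.1)) = mulOp (bgrad η'⁻¹ (liftEquiv (scShift' d L mv kk r hL μ) ι) (fun p' : ScX' d L mv kk r hL × ι => (scBump' d L mv kk r hL k) p'.1)) := fun k μ => cut_bgrad_bcube (2 * L) (fun ν (p : ScX' d L mv kk r hL × ι) => scXi' d L mv kk r hL ν p.1) 2 (fun μ => liftEquiv (scShift' d L mv kk r hL μ) ι) μ η'⁻¹ (hwin2' μ k)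
  have hh1 : ∀ k, ∀ μ p, |fgrad η⁻¹ (liftEquiv (scShift d L mv kk hL μ) ι) (fun p : ScX d L mv kk hL × ι => scH d L mv kk hL k p.1) p| ≤ (π / W) := by rw [hηinv]; exact fun k μ p => (abs_fgrad_hcube_le (2 * L) (fun ν (p : ScX d L mv kk hL × ι) => scXi d L mv kk hL ν p.1) (fun μ => liftEquiv (scShift d L mv kk hL μ) ι) hK0 hξS _ k μ p).trans hsW.le
  have hh1b : ∀ k, ∀ μ p, |bgrad η⁻¹ (liftEquiv (scShift d L mv kk hL μ) ι) (fun p : ScX d L mv kk hL × ι => scH d L mv kk hL k p.1) p| ≤ (π / W) := by rw [hηinv]; exact fun k μ p => (abs_bgrad_hcube_le (2 * L) (fun ν (p : ScX d L mv kk hL × ι) => scXi d L mv kk hL ν p.1) (fun μ => liftEquiv (scShift d L mv kk hL μ) ι) hK0 hξS _ k μ p).trans hsW.le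
  have hh1' : ∀ k, ∀ μ p', |fgrad η'⁻¹ (liftEquiv (scShift' d L mv kk r hL μ) ι) (fun p : ScX' d L mv kk r hL × ι => scH' d L mv kk r hL k p.1) p'| ≤ (π / W) := by rw [hη'inv]; exact fun k μ p => (abs_fgrad_hcube_le (2 * L) (fun ν (p : ScX' d L mv kk r hL × ι) => scXi' d L mv kk r hL ν p.1) (fun μ => liftEquiv (scShift' d L mv kk r hL μ) ι) hK0 hξS' _ k μ p).trans hsW'.le
  have hh1b' : ∀ k, ∀ μ p', |bgrad η'⁻¹ (liftEquiv (scShift' d L mv kk r hL μ) ι) (fun p : ScX' d L mv kk r hL × ι => scH' d L mv kk r hL k p.1) p'| ≤ (π / W) := by rw [hη'inv]; exact fun k μ p => (abs_bgrad_hcube_le (2 * L) (fun ν (p : ScX' d L mv kk r hL × ι) => scXi' d L mv kk r hL ν p.1) (fun μ => liftEquiv (scShift' d L mv kk r hL μ) ι) hK0 hξS' _ k μ p).trans hsW'.le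
  have hh2' : ∀ k, ∀ μ p', |fgradAdj η'⁻¹ (liftEquiv (scShift' d L mv kk r hL μ) ι) (fgrad η'⁻¹ (liftEquiv (scShift' d L mv kk r hL μ) ι) (fun p : ScX' d L mv kk r hL × ι => scH' d L mv kk r hL k p.1)) p'| ≤ (32 * π ^ 2 / W ^ 2) := by rw [hη'inv]; exact fun k μ p => (abs_fgradAdj_fgrad_hcube_le (2 * L) (fun ν (p : ScX' d L mv kk r hL × ι) => scXi' d L mv kk r hL ν p.1) (fun μ => liftEquiv (scShift' d L mv kk r hL μ) ι) hK2 hξS' hs0f hs1f _ k μ p).trans hsW2'.le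
  have hf1 : ∀ k, ∀ μ p', |fgrad η'⁻¹ (liftEquiv (scShift' d L mv kk r hL μ) ι) (fun p : ScX' d L mv kk r hL × ι => scH' d L mv kk r hL k p.1) p' - fgrad η⁻¹ (liftEquiv (scShift d L mv kk hL μ) ι) (fun p : ScX d L mv kk hL × ι => scH d L mv kk hL k p.1) (liftMap (kingPr L kk r (cvM d L mv kk hL)) ι p')| ≤ O1 := by rw [hηinv, hη'inv]; exact fun k μ p' => abs_fgrad_scH'_sub_le ι hM hw h3 k μ p'
  have hf1b : ∀ k, ∀ μ p', |bgrad η'⁻¹ (liftEquiv (scShift' d L mv kk r hL μ) ι) (fun p : ScX' d L mv kk r hL × ι => scH' d L mv kk r hL k p.1) p' - bgrad η⁻¹ (liftEquiv (scShift d L mv kk hL μ) ι) (fun p : ScX d L mv kk hL × ι => scH d L mv kk hL k p.1) (liftMap (kingPr L kk r (cvM d L mv kk hL)) ι p')| ≤ O1 := by rw [hηinv, hη'inv]; exact fun k μ p' => abs_bgrad_scH'_sub_le ι hM hw h3 k μ p'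
  have hf2 : ∀ k, ∀ μ p', |fgradAdj η'⁻¹ (liftEquiv (scShift' d L mv kk r hL μ) ι) (fgrad η'⁻¹ (liftEquiv (scShift' d L mv kk r hL μ) ι) (fun p : ScX' d L mv kk r hL × ι => scH' d L mv kk r hL k p.1)) p' - fgradAdj η⁻¹ (liftEquiv (scShift d L mv kk hL μ) ι) (fgrad η⁻¹ (liftEquiv (scShift d L mv kk hL μ) ι) (fun p : ScX d L mv kk hL × ι => scH d L mv kk hL k p.1)) (liftMap (kingPr L kk r (cvM d L mv kk hL)) ι p')| ≤ O2 := by rw [hηinv, hη'inv]; exact fun k μ p' => abs_fgradAdj_fgrad_scH'_sub_le ι hM hw h3 k μ p'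
  have hLip : ∀ k, ∀ y y', |(coverHb (cvM d L mv kk hL) (L ^ kk) (L ^ mv) L k) y - (coverHb (cvM d L mv kk hL) (L ^ kk) (L ^ mv) L k) y'| ≤ (π * (d + 1) / W) * (unitTorusGeo L kk (cvM d L mv kk hL)).dist y y' := fun k y y' => abs_coverHb_sub_le hM hw k y y'; have hrh : ∀ k (p : ScX d L mv kk hL × ι), |scH d L mv kk hL k p.1 - (coverHb (cvM d L mv kk hL) (L ^ kk) (L ^ mv) L k) (liftBlk (scBlk d L mv kk hL) ι p)| ≤ (π * (d + 1) / W) := fun k p => abs_coverH_sub_coverHb_le hM hw k (p.1, 0)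
  have hrh' : ∀ k (p' : ScX' d L mv kk r hL × ι), |scH' d L mv kk r hL k p'.1 - (coverHb (cvM d L mv kk hL) (L ^ kk) (L ^ mv) L k) (liftBlk (scBlk d L mv kk hL ∘ (kingPr L kk r (cvM d L mv kk hL))) ι p')| ≤ (π * (d + 1) / W) := fun k p' => abs_scH'_sub_coverHb_kingPr_le ι hM hw k p'; have hfh : ∀ k (p' : ScX' d L mv kk r hL × ι), |scH' d L mv kk r hL k p'.1 - scH d L mv kk hL k ((kingPr L kk r (cvM d L mv kk hL)) p'.1)| ≤ (π * (d + 1) / (((L ^ kk : ℕ) : ℝ) * W)) := fun k p' => abs_scH'_sub_scH_kingPr_le ι hM hw k p'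
  have hKN' : ∀ k, HasMaj (BlockNorm.ofBlocks (unitTorusGeo L kk (cvM d L mv kk hL)) (liftBlk (scBlk d L mv kk hL ∘ kingPr L kk r (cvM d L mv kk hL)) ι)) (BlockNorm.ofBlocks (unitTorusGeo L kk (cvM d L mv kk hL)) (liftBlk (scBlk d L mv kk hL ∘ kingPr L kk r (cvM d L mv kk hL)) ι)) (commOp (scQQ' d L mv kk r hL (aK a₀ (L : ℝ) (r + kk) * (((L ^ r * L ^ kk : ℕ) : ℝ)) ^ (d + 1)) ι) (fun p : ScX' d L mv kk r hL × ι => scH' d L mv kk r hL k p.1)) (fun y y' => ((π * (d + 1) / W * 0 + 2 * (π * (d + 1) / W)) * a₀) * Real.exp (-((δm - δm / 2) * (unitTorusGeo L kk (cvM d L mv kk hL)).dist y y'))) := fun k => hasMaj_src_tgt_congr hblk' ((hasMaj_commOp_scQQ' ι hM hw _ (δm - δm / 2) k).mono fun y y' => mul_le_mul_of_nonneg_right hcNle' (Real.exp_nonneg _))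
  have hDKN : ∀ k, HasMaj (ScNorm d L mv kk hL ι) (BlockNorm.ofBlocks (unitTorusGeo L kk (cvM d L mv kk hL)) (liftBlk (scBlk d L mv kk hL ∘ kingPr L kk r (cvM d L mv kk hL)) ι)) (idef (pull (liftMap (kingPr L kk r (cvM d L mv kk hL)) ι)) (pull (liftMap (kingPr L kk r (cvM d L mv kk hL)) ι)) (commOp (scQQ' d L mv kk r hL (aK a₀ (L : ℝ) (r + kk) * (((L ^ r * L ^ kk : ℕ) : ℝ)) ^ (d + 1)) ι) (fun p : ScX' d L mv kk r hL × ι => scH' d L mv kk r hL k p.1)) (commOp (scQQ d L mv kk hL (aK a₀ (L : ℝ) kk * (((L ^ kk : ℕ) : ℝ)) ^ (d + 1)) ι) (fun p : ScX d L mv kk hL × ι => scH d L mv kk hL k p.1))) (fun y y' => RNK * Real.exp (-((δm - δm / 2) * (unitTorusGeo L kk (cvM d L mv kk hL)).dist y y'))) := fun k => hasMaj_idef_commOp_scQQ_scH_king ι hM hw hL2R hk ha₀ (γ := (1 / 4 : ℝ)) (by norm_num) k δm (ε := δm / 2) (by positivity)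
  have hh2 : ∀ k, ∀ μ p, |fgradAdj η⁻¹ (liftEquiv (scShift d L mv kk hL μ) ι) (fgrad η⁻¹ (liftEquiv (scShift d L mv kk hL μ) ι) (fun p : ScX d L mv kk hL × ι => scH d L mv kk hL k p.1)) p| ≤ (32 * π ^ 2 / W ^ 2) := by rw [hηinv]; exact fun k μ p => (abs_fgradAdj_fgrad_hcube_le (2 * L) (fun ν (p : ScX d L mv kk hL × ι) => scXi d L mv kk hL ν p.1) (fun μ => liftEquiv (scShift d L mv kk hL μ) ι) hK2 hξS hs0c hs1c _ k μ p).trans hsW2.le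
  have hKN : ∀ k, HasMaj (ScNorm d L mv kk hL ι) (ScNorm d L mv kk hL ι) (commOp (scQQ d L mv kk hL (aK a₀ (L : ℝ) kk * (((L ^ kk : ℕ) : ℝ)) ^ (d + 1)) ι) (fun p : ScX d L mv kk hL × ι => scH d L mv kk hL k p.1)) (fun y y' => ((π * (d + 1) / W * 0 + 2 * (π * (d + 1) / W)) * a₀) * Real.exp (-((δm - δm / 2) * (unitTorusGeo L kk (cvM d L mv kk hL)).dist y y'))) := fun k => (hasMaj_commOp_scQQ ι hM hw _ (δm - δm / 2) k).mono fun y y' => mul_le_mul_of_nonneg_right hcNle (Real.exp_nonneg _)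
  have hhcut : ∀ k, mulOp (fun p : ScX d L mv kk hL × ι => scH d L mv kk hL k p.1) ∘ₗ mulOp (fun p : ScX d L mv kk hL × ι => scChi d L mv kk hL k p.1) = mulOp (fun p : ScX d L mv kk hL × ι => scH d L mv kk hL k p.1) := fun k => hcube_cut (2 * L) (fun ν (p : ScX d L mv kk hL × ι) => scXi d L mv kk hL ν p.1) (fun μ => liftEquiv (scShift d L mv kk hL μ) ι) 0 (hwin 0 k)
  have hhcut' : ∀ k, mulOp (fun p : ScX' d L mv kk r hL × ι => scH' d L mv kk r hL k p.1) ∘ₗ mulOp (fun p : ScX' d L mv kk r hL × ι => scChi' d L mv kk r hL k p.1) = mulOp (fun p : ScX' d L mv kk r hL × ι => scH' d L mv kk r hL k p.1) := fun k => hcube_cut (2 * L) (fun ν (p : ScX' d L mv kk r hL × ι) => scXi' d L mv kk r hL ν p.1) (fun μ => liftEquiv (scShift' d L mv kk r hL μ) ι) 0 (hwin' 0 k)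
  have hN : ∀ b, ∑ k, ind (g := unitTorusGeo L kk (cvM d L mv kk hL)) (cvSk d L mv kk hL k) b ≤ Nov := fun y => sum_ind_cubeBlocks_le (M := cvM d L mv kk hL) (w := L ^ mv) (q := L) (m₀ := coverMargin L mv) L kk y
  have hT : ∀ k, HasMaj (ScNorm d L mv kk hL ι) (ScNorm d L mv kk hL ι) ((-(mulOp (fun p : ScX d L mv kk hL × ι => scH d L mv kk hL k p.1) ∘ₗ (scQQ d L mv kk hL (aK a₀ (L : ℝ) kk * (((L ^ kk : ℕ) : ℝ)) ^ (d + 1)) ι) ∘ₗ mulOp (1 - fun p : ScX d L mv kk hL × ι => scBump d L mv kk hL k p.1))) ∘ₗ (scCube d L mv kk hL (aK a₀ (L : ℝ) kk * (((L ^ kk : ℕ) : ℝ)) ^ (d + 1)) ι k)) (fun y y' => ind (g := unitTorusGeo L kk (cvM d L mv kk hL)) (cvSk d L mv kk hL k) y * ind (g := unitTorusGeo L kk (cvM d L mv kk hL)) (cvSk d L mv kk hL k) y' * ((0:ℝ) * Real.exp (-((δm / 2) * (unitTorusGeo L kk (cvM d L mv kk hL)).dist y y')))) := fun k => by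
    rw [mulOp_scH_comp_scQQ_comp_one_sub_scBump ι hw _ k, neg_zero, LinearMap.zero_comp]
    exact (hasMaj_zero _ _).mono fun y y' => mul_nonneg (mul_nonneg (ind_nonneg _ _) (ind_nonneg _ _)) (by positivity)
  have hT' : ∀ k, HasMaj (BlockNorm.ofBlocks (unitTorusGeo L kk (cvM d L mv kk hL)) (liftBlk (scBlk d L mv kk hL ∘ kingPr L kk r (cvM d L mv kk hL)) ι)) (BlockNorm.ofBlocks (unitTorusGeo L kk (cvM d L mv kk hL)) (liftBlk (scBlk d L mv kk hL ∘ kingPr L kk r (cvM d L mv kk hL)) ι)) ((-(mulOp (fun p : ScX' d L mv kk r hL × ι => scH' d L mv kk r hL k p.1) ∘ₗ (scQQ' d L mv kk r hL (aK a₀ (L : ℝ) (r + kk) * (((L ^ r * L ^ kk : ℕ) : ℝ)) ^ (d + 1)) ι) ∘ₗ mulOp (1 - fun p : ScX' d L mv kk r hL × ι => scBump' d L mv kk r hL k p.1))) ∘ₗ (scCube' d L mv kk r hL (aK a₀ (L : ℝ) (r + kk) * (((L ^ r * L ^ kk : ℕ) : ℝ)) ^ (d + 1)) ι k)) (fun y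 y' => ind (g := unitTorusGeo L kk (cvM d L mv kk hL)) (cvSk d L mv kk hL k) y * ind (g := unitTorusGeo L kk (cvM d L mv kk hL)) (cvSk d L mv kk hL k) y' * ((0:ℝ) * Real.exp (-((δm / 2) * (unitTorusGeo L kk (cvM d L mv kk hL)).dist y y')))) := fun k => by
    rw [mulOp_scH'_comp_scQQ'_comp_one_sub_scBump' ι hw _ k, neg_zero, LinearMap.zero_comp]
    exact (hasMaj_zero _ _).mono fun y y' => mul_nonneg (mul_nonneg (ind_nonneg _ _) (ind_nonneg _ _)) (by positivity)
  have hDT : ∀ k, HasMaj (ScNorm d L mv kk hL ι) (BlockNorm.ofBlocks (unitTorusGeo L kk (cvM d L mv kk hL)) (liftBlk (scBlk d L mv kk hL ∘ kingPr L kk r (cvM d L mv kk hL)) ι)) (idef (pull (liftMap (kingPr L kk r (cvM d L mv kk hL)) ι)) (pull (liftMap (kingPr L kk r (cvM d L mv kk hL)) ι)) ((-(mulOp (fun p : ScX' d L mv kk r hL × ι => scH' d L mv kk r hL k p.1) ∘ₗ (scQQ' d L mv kk r hL (aK a₀ (L : ℝ) (r + kk) * (((L ^ r * L ^ kk : ℕ)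 : ℝ)) ^ (d + 1)) ι) ∘ₗ mulOp (1 - fun p : ScX' d L mv kk r hL × ι => scBump' d L mv kk r hL k p.1))) ∘ₗ (scCube' d L mv kk r hL (aK a₀ (L : ℝ) (r + kk) * (((L ^ r * L ^ kk : ℕ) : ℝ)) ^ (d + 1)) ι k)) ((-(mulOp (fun p : ScX d L mv kk hL × ι => scH d L mv kk hL k p.1) ∘ₗ (scQQ d L mv kk hL (aK a₀ (L : ℝ) kk * (((L ^ kk : ℕ) : ℝ)) ^ (d + 1)) ι) ∘ₗ mulOp (1 - fun p : ScX d L mv kk hL × ι => scBump d L mv kk hL k p.1))) ∘ₗ (scCube d L mv kk hL (aK a₀ (L : ℝ) kk * (((L ^ kk : ℕ) : ℝ)) ^ (d + 1)) ι k))) (fun y y' => ind (g := unitTorusGeo L kk (cvM d L mv kk hL)) (cvSk d L mv kk hL k) y * ind (g := unitTorusGeo L kk (cvM d L mv kk hL)) (cvSk d L mv kk hL k) y' * ((0:ℝ) * Real.exp (-((δm / 2) * (unitTorusGeo L kk (cvM d L mv kk hL)).dist y y')))) := fun k => hasMaj_idef_tail_scCube ι hw _ _ le_rfl _ k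
  have hψχ : ∀ k, mulOp (fun p : ScX d L mv kk hL × ι => scPsi d L mv kk hL k p.1) ∘ₗ mulOp (fun p : ScX d L mv kk hL × ι => scChi d L mv kk hL k p.1) = mulOp (fun p : ScX d L mv kk hL × ι => scChi d L mv kk hL k p.1) := fun k => mulOp_comp_mulOp_of_support_left fun p hp => chiCube_eq_one_of_inner_ne_zero hM hm₁ hfitI hS0 hp
  have hψχ' : ∀ k, mulOp (fun p : ScX' d L mv kk r hL × ι => scPsi' d L mv kk r hL k p.1) ∘ₗ mulOp (fun p : ScX' d L mv kk r hL × ι => scChi' d L mv kk r hL k p.1) = mulOp (fun p : ScX' d L mv kk r hL × ι => scChi' d L mv kk r hL k p.1) := fun k => mulOp_comp_mulOp_of_support_left fun p hp => chiCube_eq_one_of_inner_ne_zero hM hm₁ hfitI hS0 hp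
  have hNVcut' : ∀ k, HasMaj (BlockNorm.ofBlocks (unitTorusGeo L kk (cvM d L mv kk hL)) (liftBlk (scBlk d L mv kk hL ∘ kingPr L kk r (cvM d L mv kk hL)) ι)) (BlockNorm.ofBlocks (unitTorusGeo L kk (cvM d L mv kk hL)) (liftBlk (scBlk d L mv kk hL ∘ kingPr L kk r (cvM d L mv kk hL)) ι)) (mulOp (fun p : ScX' d L mv kk r hL × ι => scPsi' d L mv kk r hL k p.1) ∘ₗ NV' k ∘ₗ mulOp (fun p : ScX' d L mv kk r hL × ι => scChi' d L mv kk r hL k p.1)) (fun y y' => RN * Real.exp (-(δm * (unitTorusGeo L kk (cvM d L mv kk hL)).dist y y'))) := fun k => hasMaj_src_tgt_congr hblk' (hNVcut' k)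
  have hfarN : ∀ k, HasMaj (ScNorm d L mv kk hL ι) (ScNorm d L mv kk hL ι) ((LinearMap.id - mulOp (fun p : ScX d L mv kk hL × ι => scPsi d L mv kk hL k p.1)) ∘ₗ NV k ∘ₗ mulOp (fun p : ScX d L mv kk hL × ι => scChi d L mv kk hL k p.1)) (fun y y' => θ₀ * Real.exp (-(δm * (unitTorusGeo L kk (cvM d L mv kk hL)).dist y y'))) := fun k => (hfarN k).mono fun y y' => mul_le_mul_of_nonneg_right hθle (Real.exp_nonneg _)
  have hfarN' : ∀ k, HasMaj (BlockNorm.ofBlocks (unitTorusGeo L kk (cvM d L mv kk hL)) (liftBlk (scBlk d L mv kk hL ∘ kingPr L kk r (cvM d L mv kk hL)) ι)) (BlockNorm.ofBlocks (unitTorusGeo L kk (cvM d L mv kk hL)) (liftBlk (scBlk d L mv kk hL ∘ kingPr L kk r (cvM d L mv kk hL)) ι)) ((LinearMap.id - mulOp (fun p : ScX' d L mv kk r hL × ι => scPsi' d L mv kk r hL k p.1)) ∘ₗ NV' k ∘ₗ mulOp (fun p : ScX' d L mv kk r hL × ι => scChi' d L mv kk r hL k p.1)) (fun y y' => θ₀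 * Real.exp (-(δm * (unitTorusGeo L kk (cvM d L mv kk hL)).dist y y'))) := fun k => hasMaj_src_tgt_congr hblk' ((hfarN' k).mono fun y y' => mul_le_mul_of_nonneg_right hθle (Real.exp_nonneg _))
  have hhψ : ∀ k, mulOp (fun p : ScX d L mv kk hL × ι => scH d L mv kk hL k p.1) ∘ₗ mulOp (fun p : ScX d L mv kk hL × ι => scPsi d L mv kk hL k p.1) = mulOp (fun p : ScX d L mv kk hL × ι => scH d L mv kk hL k p.1) := fun k => mulOp_scH_comp_mulOp_scPsi ι hM hw hfit k
  have hχh : ∀ k, mulOp (fun p : ScX d L mv kk hL × ι => scChi d L mv kk hL k p.1) ∘ₗ mulOp (fun p : ScX d L mv kk hL × ι => scH d L mv kk hL k p.1) = mulOp (fun p : ScX d L mv kk hL × ι => scH d L mv kk hL k p.1) := fun k => cut_hcube (2 * L) (fun ν (p : ScX d L mv kk hL × ι) => scXi d L mv kk hL ν p.1) 2 (fun μ => liftEquiv (scShift d L mv kk hL μ) ι) 0 (by norm_num) (hwin2 0 k)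
  have hhs' : ∀ k μ, mulOp (fun p : ScX d L mv kk hL × ι => scChi d L mv kk hL k p.1) ∘ₗ mulOp ((fun p : ScX d L mv kk hL × ι => scH d L mv kk hL k p.1) ∘ (liftEquiv (scShift d L mv kk hL μ) ι)) = mulOp ((fun p : ScX d L mv kk hL × ι => scH d L mv kk hL k p.1) ∘ (liftEquiv (scShift d L mv kk hL μ) ι)) := fun k μ => cut_hcube_comp_shift (2 * L) (fun ν (p : ScX d L mv kk hL × ι) => scXi d L mv kk hL ν p.1) 2 (fun μ => liftEquiv (scShift d L mv kk hL μ) ι) μ (by norm_num) (hwin2 μ k)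
  have hhsb' : ∀ k μ, mulOp (fun p : ScX d L mv kk hL × ι => scChi d L mv kk hL k p.1) ∘ₗ mulOp ((fun p : ScX d L mv kk hL × ι => scH d L mv kk hL k p.1) ∘ (liftEquiv (scShift d L mv kk hL μ) ι).symm) = mulOp ((fun p : ScX d L mv kk hL × ι => scH d L mv kk hL k p.1) ∘ (liftEquiv (scShift d L mv kk hL μ) ι).symm) := fun k μ => cut_hcube_comp_shift_symm (2 * L) (fun ν (p : ScX d L mv kk hL × ι) => scXi d L mv kk hL ν p.1) 2 (fun μ => liftEquiv (scShift d L mv kk hL μ) ι) μ (by norm_num) (hwin2 μ k)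
  have hhdd' : ∀ k μ, mulOp (fun p : ScX d L mv kk hL × ι => scChi d L mv kk hL k p.1) ∘ₗ mulOp (fgrad η⁻¹ (liftEquiv (scShift d L mv kk hL μ) ι) (fun p : ScX d L mv kk hL × ι => scH d L mv kk hL k p.1)) = mulOp (fgrad η⁻¹ (liftEquiv (scShift d L mv kk hL μ) ι) (fun p : ScX d L mv kk hL × ι => scH d L mv kk hL k p.1)) := fun k μ => cut_fgrad_hcube (2 * L) (fun ν (p : ScX d L mv kk hL × ι) => scXi d L mv kk hL ν p.1) 2 (fun μ => liftEquiv (scShift d L mv kk hL μ) ι) μ (by norm_num) η⁻¹ (hwin2 μ k)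
  have hhddb' : ∀ k μ, mulOp (fun p : ScX d L mv kk hL × ι => scChi d L mv kk hL k p.1) ∘ₗ mulOp (bgrad η⁻¹ (liftEquiv (scShift d L mv kk hL μ) ι) (fun p : ScX d L mv kk hL × ι => scH d L mv kk hL k p.1)) = mulOp (bgrad η⁻¹ (liftEquiv (scShift d L mv kk hL μ) ι) (fun p : ScX d L mv kk hL × ι => scH d L mv kk hL k p.1)) := fun k μ => cut_bgrad_hcube (2 * L) (fun ν (p : ScX d L mv kk hL × ι) => scXi d L mv kk hL ν p.1) 2 (fun μ => liftEquiv (scShift d L mv kk hL μ) ι) μ (by norm_num) η⁻¹ (hwin2 μ k)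
  have hhψf : ∀ k, mulOp (fun p : ScX' d L mv kk r hL × ι => scH' d L mv kk r hL k p.1) ∘ₗ mulOp (fun p : ScX' d L mv kk r hL × ι => scPsi' d L mv kk r hL k p.1) = mulOp (fun p : ScX' d L mv kk r hL × ι => scH' d L mv kk r hL k p.1) := fun k => mulOp_scH'_comp_mulOp_scPsi' ι hM hw hfit k
  have hχhf : ∀ k, mulOp (fun p : ScX' d L mv kk r hL × ι => scChi' d L mv kk r hL k p.1) ∘ₗ mulOp (fun p : ScX' d L mv kk r hL × ι => scH' d L mv kk r hL k p.1) = mulOp (fun p : ScX' d L mv kk r hL × ι => scH' d L mv kk r hL k p.1) := fun k => cut_hcube (2 * L) (fun ν (p : ScX' d L mv kk r hL × ι) => scXi' d L mv kk r hL ν p.1) 2 (fun μ => liftEquiv (scShift' d L mv kk r hL μ) ι) 0 (by norm_num) (hwin2' 0 k)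
  have hhsf : ∀ k μ, mulOp (fun p : ScX' d L mv kk r hL × ι => scChi' d L mv kk r hL k p.1) ∘ₗ mulOp ((fun p : ScX' d L mv kk r hL × ι => scH' d L mv kk r hL k p.1) ∘ (liftEquiv (scShift' d L mv kk r hL μ) ι)) = mulOp ((fun p : ScX' d L mv kk r hL × ι => scH' d L mv kk r hL k p.1) ∘ (liftEquiv (scShift' d L mv kk r hL μ) ι)) := fun k μ => cut_hcube_comp_shift (2 * L) (fun ν (p : ScX' d L mv kk r hL × ι) => scXi' d L mv kk r hL ν p.1) 2 (fun μ => liftEquiv (scShift' d L mv kk r hL μ) ι) μ (by norm_num) (hwin2' μ k)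
  have hhsbf : ∀ k μ, mulOp (fun p : ScX' d L mv kk r hL × ι => scChi' d L mv kk r hL k p.1) ∘ₗ mulOp ((fun p : ScX' d L mv kk r hL × ι => scH' d L mv kk r hL k p.1) ∘ (liftEquiv (scShift' d L mv kk r hL μ) ι).symm) = mulOp ((fun p : ScX' d L mv kk r hL × ι => scH' d L mv kk r hL k p.1) ∘ (liftEquiv (scShift' d L mv kk r hL μ) ι).symm) := fun k μ => cut_hcube_comp_shift_symm (2 * L) (fun ν (p : ScX' d L mv kk r hL × ι) => scXi' d L mv kk r hL ν p.1) 2 (fun μ => liftEquiv (scShift' d L mv kk r hL μ) ι) μ (by norm_num) (hwin2' μ k)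
  have hhddf : ∀ k μ, mulOp (fun p : ScX' d L mv kk r hL × ι => scChi' d L mv kk r hL k p.1) ∘ₗ mulOp (fgrad η'⁻¹ (liftEquiv (scShift' d L mv kk r hL μ) ι) (fun p : ScX' d L mv kk r hL × ι => scH' d L mv kk r hL k p.1)) = mulOp (fgrad η'⁻¹ (liftEquiv (scShift' d L mv kk r hL μ) ι) (fun p : ScX' d L mv kk r hL × ι => scH' d L mv kk r hL k p.1)) := fun k μ => cut_fgrad_hcube (2 * L) (fun ν (p : ScX' d L mv kk r hL × ι) => scXi' d L mv kk r hL ν p.1) 2 (fun μ => liftEquiv (scShift' d L mv kk r hL μ) ι) μ (by norm_num) η'⁻¹ (hwin2' μ k)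
  have hhddbf : ∀ k μ, mulOp (fun p : ScX' d L mv kk r hL × ι => scChi' d L mv kk r hL k p.1) ∘ₗ mulOp (bgrad η'⁻¹ (liftEquiv (scShift' d L mv kk r hL μ) ι) (fun p : ScX' d L mv kk r hL × ι => scH' d L mv kk r hL k p.1)) = mulOp (bgrad η'⁻¹ (liftEquiv (scShift' d L mv kk r hL μ) ι) (fun p : ScX' d L mv kk r hL × ι => scH' d L mv kk r hL k p.1)) := fun k μ => cut_bgrad_hcube (2 * L) (fun ν (p : ScX' d L mv kk r hL × ι) => scXi' d L mv kk r hL ν p.1) 2 (fun μ => liftEquiv (scShift' d L mv kk r hL μ) ι) μ (by norm_num) η'⁻¹ (hwin2' μ k)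
  have hTk : ∀ k, (ctauS (cvM d L mv kk hL) L kk r (fun μ x' => coordMat e (ContinuousLinearMap.mulLeftRight ℝ (Matrix mm mm ℂ) (U' μ x') (U' μ x')ᴴ))) = mmulOp (fun x' => (coordMat e (ContinuousLinearMap.mulLeftRight ℝ (Matrix mm mm ℂ) (u' k x') (u' k x')ᴴ))ᵀ) ∘ₗ (mmulOp (fun x' => (kingStairT (cvM d L mv kk hL) (L ^ r * L ^ kk) (L ^ r) (fun μ b => coordMat e (ContinuousLinearMap.mulLeftRight ℝ (Matrix mm mm ℂ) (u' k b.1 * U' μ b.1 * (u' k (b.1 + unitVec (fine (L ^ r * L ^ kk) (cvM d L mv kk hL)) μ))ᴴ) (u' k b.1 * U' μ b.1 * (u' k (b.1 + unitVec (fine (L ^ r * L ^ kk) (cvM d L mv kk hL)) μ))ᴴ)ᴴ)) (x', 0))ᵀ) ∘ₗ pull (liftMap (kingPr L kk r (cvM d L mv kk hL)) ι)) ∘ₗ mmulOp (fun x => coordMat e (ContinuousLinearMap.mulLeftRight ℝ (Matrix mm mm ℂ) (u' k (kingSec (cvM d L mv kk hL) L kk r x)) (u' k (kingSec (cvM d L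 mv kk hL) L kk r x))ᴴ)) := fun k => ctauS_coordMat_Ad_eq_conj (cvM d L mv kk hL) L kk r e he (hu' k) U'
  have hΨ : ∀ x' i j, |(kingStairT (cvM d L mv kk hL) (L ^ r * L ^ kk) (L ^ r) (fun μ b => coordMat e (ContinuousLinearMap.mulLeftRight ℝ (Matrix mm mm ℂ) (U' μ b.1) (U' μ b.1)ᴴ)) (x', 0))ᵀ i j| ≤ 1 := fun x' i j => abs_kingStairT_coordMat_Ad_transpose_le_one (cvM d L mv kk hL) L kk r e he hU' (x', 0) i j
  have hψoh : ∀ k, mulOp (fun p : ScX d L mv kk hL × ι => scPsi d L mv kk hL k p.1) ∘ₗ mulOp (fun p : ScX d L mv kk hL × ι => scH d L mv kk hL k p.1) = mulOp (fun p : ScX d L mv kk hL × ι => scH d L mv kk hL k p.1) := fun k => by rw [mulOp_comp_mulOp_comm]; exact mulOp_scH_comp_mulOp_scPsi ι hM hw hfit k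
  have hKout : ∀ k, mulOp (fun p : ScX d L mv kk hL × ι => scPsi d L mv kk hL k p.1) ∘ₗ (commOp (mmulOp (fun x => coordMat e (ContinuousLinearMap.mulLeftRight ℝ (Matrix mm mm ℂ) (u' k (kingSec (cvM d L mv kk hL) L kk r x)) (u' k (kingSec (cvM d L mv kk hL) L kk r x))ᴴ)) ∘ₗ (covLapM (scShift d L mv kk hL) η (gaugePair (scShift d L mv kk hL) (fun μ x => coordMat e (ContinuousLinearMap.mulLeftRight ℝ (Matrix mm mm ℂ) (U μ x) (U μ x)ᴴ))) + P) ∘ₗ mmulOp (fun x => (coordMat e (ContinuousLinearMap.mulLeftRight ℝ (Matrix mm mm ℂ) (u' k (kingSec (cvM d L mv kk hL) L kk r x)) (u' k (kingSec (cvM d L mv kk hL) L kk r x))ᴴ))ᵀ)) (fun p : ScX d L mv kk hL × ι => scH d L mv kk hL k p.1) ∘ₗ (projO none ∘ₗ bgPropV (stack (mulOp (fun p : ScX d L mv kk hL × ι => scBump d L mv kk hL k p.1) ∘ₗ (scCube d L mv kk hL (aK a₀ (L : ℝ) kk * (((L ^ kk : ℕ) : ℝ)) ^ (d + 1)) ι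 k)) (fun j => Sum.elim (fun μ => fgrad η⁻¹ (liftEquiv
      (scShift d L mv kk hL μ) ι)) (fun μ => bgrad η⁻¹ (liftEquiv (scShift d L mv kk hL μ) ι)) j ∘ₗ (mulOp (fun p : ScX d L mv kk hL × ι => scBump d L mv kk hL k p.1) ∘ₗ (scCube d L mv kk hL (aK a₀ (L : ℝ) kk * (((L ^ kk : ℕ) : ℝ)) ^ (d + 1)) ι k)))) (mulOp (fun p : ScX d L mv kk hL × ι => scPsi d L mv kk hL k p.1) ∘ₗ (unstackM (tCoefC η (gaugePair (scShift d L mv kk hL) fun μ x => coordMat e (ContinuousLinearMap.mulLeftRight ℝ (Matrix mm mm ℂ) (u' k (kingSec (cvM d L mv kk hL) L kk r x) * U μ x * (u' k (kingSec (cvM d L mv kk hL) L kk r (scShift d L mv kk hL μ x)))ᴴ) (u' k (kingSec (cvM d L mv kk hL) L kk r x) * U μ x * (u' k (kingSec (cvM d L mv kk hL) L kk r (scShift d L mv kk hL μ x)))ᴴ)ᴴ))) (tCoefA η (gaugePair (scShift d L mv kk hL) fun μ x => coordMat e (ContinuousLinearMap.mulLeftRight ℝ (Matrix mm mm ℂ)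 (u' k (kingSec (cvM d L mv kk hL) L kk r x) * U μ x * (u' k (kingSec (cvM d
      L mv kk hL) L kk r (scShift d L mv kk hL μ x)))ᴴ) (u' k (kingSec (cvM d L mv kk hL) L kk r x) * U μ x * (u' k (kingSec (cvM d L mv kk hL) L kk r (scShift d L mv kk hL μ x)))ᴴ)ᴴ))) + NV k ∘ₗ projO none) ∘ₗ mulOp (fun q : (ScX d L mv kk hL × ι) × Option (Fin (d + 1) ⊕ Fin (d + 1)) => scChi d L mv kk hL k q.1.1)))) = commOp (mmulOp (fun x => coordMat e (ContinuousLinearMap.mulLeftRight ℝ (Matrix mm mm ℂ) (u' k (kingSec (cvM d L mv kk hL) L kk r x)) (u' k (kingSec (cvM d L mv kk hL) L kk r x))ᴴ)) ∘ₗ (covLapM (scShift d L mv kk hL) η (gaugePair (scShift d L mv kk hL) (fun μ x => coordMat e (ContinuousLinearMap.mulLeftRight ℝ (Matrix mm mm ℂ) (U μ x) (U μ x)ᴴ))) + P) ∘ₗ mmulOp (fun x => (coordMat e (ContinuousLinearMap.mulLeftRight ℝ (Matrix mm mm ℂ) (u' k (kingSec (cvM d L mv kk hL) L kk r x)) (u'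 k (kingSec (cvM d L mv kk hL) L kk r x))ᴴ))ᵀ)) (fun p : ScX d L mv kk hL × ι => scH d L mv
      kk hL k p.1) ∘ₗ (projO none ∘ₗ bgPropV (stack (mulOp (fun p : ScX d L mv kk hL × ι => scBump d L mv kk hL k p.1) ∘ₗ (scCube d L mv kk hL (aK a₀ (L : ℝ) kk * (((L ^ kk : ℕ) : ℝ)) ^ (d + 1)) ι k)) (fun j => Sum.elim (fun μ => fgrad η⁻¹ (liftEquiv (scShift d L mv kk hL μ) ι)) (fun μ => bgrad η⁻¹ (liftEquiv (scShift d L mv kk hL μ) ι)) j ∘ₗ (mulOp (fun p : ScX d L mv kk hL × ι => scBump d L mv kk hL k p.1) ∘ₗ (scCube d L mv kk hL (aK a₀ (L : ℝ) kk * (((L ^ kk : ℕ) : ℝ)) ^ (d + 1)) ι k)))) (mulOp (fun p : ScX d L mv kk hL × ι => scPsi d L mv kk hL k p.1) ∘ₗ (unstackM (tCoefC η (gaugePair (scShift d L mv kk hL) fun μ x => coordMat e (ContinuousLinearMap.mulLeftRight ℝ (Matrix mm mm ℂ) (u' k (kingSec (cvM d L mv kk hL) L kk r x) * U μ x * (u'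 k (kingSec (cvM d L mv kk hL) L kk r (scShift d L mv kk hL μ x)))ᴴ) (u' k (kingSec (cvM d L mv kk hL) L kk r x) * U μ x * (u' k (kingSec (cvM d L mv
      kk hL) L kk r (scShift d L mv kk hL μ x)))ᴴ)ᴴ))) (tCoefA η (gaugePair (scShift d L mv kk hL) fun μ x => coordMat e (ContinuousLinearMap.mulLeftRight ℝ (Matrix mm mm ℂ) (u' k (kingSec (cvM d L mv kk hL) L kk r x) * U μ x * (u' k (kingSec (cvM d L mv kk hL) L kk r (scShift d L mv kk hL μ x)))ᴴ) (u' k (kingSec (cvM d L mv kk hL) L kk r x) * U μ x * (u' k (kingSec (cvM d L mv kk hL) L kk r (scShift d L mv kk hL μ x)))ᴴ)ᴴ))) + NV k ∘ₗ projO none) ∘ₗ mulOp (fun q : (ScX d L mv kk hL × ι) × Option (Fin (d + 1) ⊕ Fin (d + 1)) => scChi d L mv kk hL k q.1.1))) := fun k => mulOp_comp_commOp_conj_comp_of_support (fun x => coordMat e (ContinuousLinearMap.mulLeftRight ℝ (Matrix mm mm ℂ) (u' k (kingSec (cvM d L mv kk hL) L kk r x)) (u' k (kingSec (cvM d L mv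 kk hL) L kk r x))ᴴ)) (fun x => (coordMat e (ContinuousLinearMap.mulLeftRight ℝ (Matrix mm mm ℂ) (u' k (kingSec (cvM d L mv kk hL) L kk r x)) (u' k (kingSec (cvM d L mv kk hL) L kk r x))ᴴ))ᵀ) _ (fun x hx => (scPsi_near_scChi hM hmg₂ hfg₂ hS0 0 k (hhχ k x hx)).1) (mulOp_comp_add_comp_mulOp_eq_zero (mulOp_one_sub_scPsi_comp_covLapM_comp_mulOp_scH ι hM hmg₂ hfg₂ hS0 η _ k (hhχ k)) (hPloc k))
  have hSin : ∀ k x' i, ∑ j, |(scPsi' d L mv kk r hL k x' • ((kingStairT (cvM d L mv kk hL) (L ^ r * L ^ kk) (L ^ r) (fun μ b => coordMat e (ContinuousLinearMap.mulLeftRight ℝ (Matrix mm mm ℂ) (u' k b.1 * U' μ b.1 * (u' k (b.1 + unitVec (fine (L ^ r * L ^ kk) (cvM d L mv kk hL)) μ))ᴴ) (u' k b.1 * U' μ b.1 * (u' k (b.1 + unitVec (fine (L ^ r * L ^ kk) (cvM d L mv kk hL)) μ))ᴴ)ᴴ)) (x', 0))ᵀ - 1)) i j| ≤ sS := fun k x'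 i => smear_cols_kingStairT_coordMat_Ad_transpose_sub_one_le (cvM d L mv kk hL) L kk r e hLr (u' k) U' hρ0 (cvSk d L mv kk hL k) (hρ k) (ψ := scPsi' d L mv kk r hL k) (fun x' => abs_chiCube_le_one _ _) (fun x' hx => by rw [← blockOf_kingPr (cvM d L mv kk hL) L kk r x']; exact scBlk_kingPr_mem_cvSk_of_scPsi'_ne_zero hx) x' i
  have hSout : ∀ k x' i, ∑ j, |(scPsi d L mv kk hL k ((kingPr L kk r (cvM d L mv kk hL)) x') • ((kingStairT (cvM d L mv kk hL) (L ^ r * L ^ kk) (L ^ r) (fun μ b => coordMat e (ContinuousLinearMap.mulLeftRight ℝ (Matrix mm mm ℂ) (u' k b.1 * U' μ b.1 * (u' k (b.1 + unitVec (fine (L ^ r * L ^ kk) (cvM d L mv kk hL)) μ))ᴴ) (u' k b.1 * U' μ b.1 * (u' k (b.1 + unitVec (fine (L ^ r * L ^ kk) (cvM d L mv kk hL)) μ))ᴴ)ᴴ)) (x', 0))ᵀ - 1)) i j| ≤ sS := fun k x' i => smear_cols_kingStairT_coordMat_Ad_transpose_sub_one_le_kingPr (cvM d L mv kk hL) L kk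 r e hLr (u' k) U' hρ0 (cvSk d L mv kk hL k) (hρ k) (ψo := scPsi d L mv kk hL k) (fun x => abs_chiCube_le_one _ _) (fun x hx => scBlk_mem_cvSk_of_scPsi_ne_zero hx) x' i
  -- (J) King's pairing dichotomy in the direction `μ₀`, the one-step margin of the cut inside the cube's blocks ∕ plateau
  have hcross_ : ∀ x' : ScX' d L mv kk r hL, kingPr L kk r (cvM d L mv kk hL) (scShift' d L mv kk r hL μ₀ x') = kingPr L kk r (cvM d L mv kk hL) x' ∨ kingPr L kk r (cvM d L mv kk hL) (scShift' d L mv kk r hL μ₀ x') = scShift d L mv kk hL μ₀ (kingPr L kk r (cvM d L mv kk hL) x') := fun x' => by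
    have h := kingPr_add_unitVec (cvM d L mv kk hL) L kk r x' μ₀
    show kingPr L kk r (cvM d L mv kk hL) (x' + unitVec (fine (L ^ r * L ^ kk) (cvM d L mv kk hL)) μ₀) = kingPr L kk r (cvM d L mv kk hL) x' ∨ kingPr L kk r (cvM d L mv kk hL) (x' + unitVec (fine (L ^ r * L ^ kk) (cvM d L mv kk hL)) μ₀) = kingPr L kk r (cvM d L mv kk hL) x' + unitVec (fine (L ^ kk) (cvM d L mv kk hL)) μ₀
    rw [h]; split_ifs
    · exact Or.inr rfl
    · exact Or.inl rfl
  have hSχe_ : ∀ (k : Fin (d + 1) → ZMod (2 * L)) (x : ScX d L mv kk hL), scChi d L mv kk hL k (scShift d L mv kk hL μ₀ x) ≠ 0 → scBlk d L mv kk hL x ∈ cvSk d L mv kk hL k := fun k x hx => by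
    have h := (scPsi_near_scChi hM hmg₂ hfg₂ hS0 μ₀ k hx).2.2
    rw [Equiv.symm_apply_apply] at h
    exact scBlk_mem_cvSk_of_scPsi_ne_zero (by rw [h]; exact one_ne_zero)
  have hψe_ : ∀ (k : Fin (d + 1) → ZMod (2 * L)) (x : ScX d L mv kk hL), scChi d L mv kk hL k (scShift d L mv kk hL μ₀ x) ≠ 0 → scPsi d L mv kk hL k x = 1 := fun k x hx => by
    have h := (scPsi_near_scChi hM hmg₂ hfg₂ hS0 μ₀ k hx).2.2
    rwa [Equiv.symm_apply_apply] at h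
  -- 411 at the cover
  have key := uN_hasMaj_idef_covD_glueInv_smoothCutDressed_cross_tr (X := ScX d L mv kk hL) (X' := ScX' d L mv kk r hL) (ι := ι) (J := Fin (d + 1)) (K := Fin (d + 1) → ZMod (2 * L))
    (g := unitTorusGeo L kk (cvM d L mv kk hL)) (scBlk d L mv kk hL) (kingPr L kk r (cvM d L mv kk hL)) (kingSec (cvM d L mv kk hL) L kk r) (scShift d L mv kk hL) (scShift' d L mv kk r hL)
    (T := ctauS (cvM d L mv kk hL) L kk r (fun μ x' => coordMat e (ContinuousLinearMap.mulLeftRight ℝ (Matrix mm mm ℂ) (U' μ x') (U' μ x')ᴴ)))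
    (St := fun k x' => kingStairT (cvM d L mv kk hL) (L ^ r * L ^ kk) (L ^ r) (fun μ b => coordMat e (ContinuousLinearMap.mulLeftRight ℝ (Matrix mm mm ℂ) (u' k b.1 * U' μ b.1 * (u' k (b.1 + unitVec (fine (L ^ r * L ^ kk) (cvM d L mv kk hL)) μ))ᴴ) (u' k b.1 * U' μ b.1 * (u' k (b.1 + unitVec (fine (L ^ r * L ^ kk) (cvM d L mv kk hL)) μ))ᴴ)ᴴ)) (x', 0))
    (Ψ := fun x' => kingStairT (cvM d L mv kk hL) (L ^ r * L ^ kk) (L ^ r) (fun μ b => coordMat e (ContinuousLinearMap.mulLeftRight ℝ (Matrix mm mm ℂ) (U' μ b.1) (U' μ b.1)ᴴ)) (x', 0))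
    (N := scCube d L mv kk hL (aK a₀ (L : ℝ) kk * (((L ^ kk : ℕ) : ℝ)) ^ (d + 1)) ι) (N' := scCube' d L mv kk r hL (aK a₀ (L : ℝ) (r + kk) * (((L ^ r * L ^ kk : ℕ) : ℝ)) ^ (d + 1)) ι)
    (NL := scQQ d L mv kk hL (aK a₀ (L : ℝ) kk * (((L ^ kk : ℕ) : ℝ)) ^ (d + 1)) ι) (NL' := scQQ' d L mv kk r hL (aK a₀ (L : ℝ) (r + kk) * (((L ^ r * L ^ kk : ℕ) : ℝ)) ^ (d + 1)) ι)
    (χX := scChi d L mv kk hL) (χtX := scBump d L mv kk hL) (ψX := scPsi d L mv kk hL) (hX := scH d L mv kk hL) (ψo := scPsi d L mv kk hL)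
    (χX' := scChi' d L mv kk r hL) (χtX' := scBump' d L mv kk r hL) (ψX' := scPsi' d L mv kk r hL) (hX' := scH' d L mv kk r hL)
    (Sk := cvSk d L mv kk hL) (hb := coverHb (cvM d L mv kk hL) (L ^ kk) (L ^ mv) L) (σ := δm / 32) (cr := cr) (β := β) (β₁ := β₁) (ct := π / W) (m₀ := C * εk) (m₁ := C * εk) (oχ := π * (d + 1) / (((L ^ kk : ℕ) : ℝ) * W)) (oχ₁ := 2 * (π * (d + 1) / (((L ^ kk : ℕ) : ℝ) * W))) (oχ₂ := (W)⁻¹ * (((L ^ kk : ℕ) : ℝ) * W)⁻¹ * (32 * π ^ 4 + π ^ 2 * (d + 1))) (δ := δm) (ρ₁ := δm / 2) (ρ₂ := δm / 4) (ρ₃ := δm / 8) (ρN := δm - δm / 2) (ρT := δm / 2) (δV := δm) (ε := δm / 2) (R := R) (o := o) (c₁ := π / W) (c₂ := 32 * π ^ 2 / W ^ 2) (o₁ := O1) (o₂ := O2) (rW := 0) (θW := 0) (cN := (π * (d + 1) / W * 0 + 2 * (π * (d + 1) / W)) * a₀) (rN := RNK) (ℓ := π * (d + 1) / W) (ω :=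 π * (d + 1) / W) (d₁ := 1) (oo := π * (d + 1) / (((L ^ kk : ℕ) : ℝ) * W)) (ε₀ := 0) (rF := 0) (Nov := Nov) (s := sS)
    (rV := rV) (RN := RN) (θF := θ₀) (ρF := δm) (rD := rD) (oV := oV) (oN := oN) (η := η) (η' := η')
    (μ₀ := μ₀) (Rμ := (fun x => coordMat e (ContinuousLinearMap.mulLeftRight ℝ (Matrix mm mm ℂ) (U μ₀ x) (U μ₀ x)ᴴ))) (Rμ' := (fun x' => coordMat e (ContinuousLinearMap.mulLeftRight ℝ (Matrix mm mm ℂ) (U' μ₀ x') (U' μ₀ x')ᴴ))) (hsX := fun k x => scH d L mv kk hL k (scShift d L mv kk hL μ₀ x)) (dhX := fun k x => ((((L ^ kk : ℕ) : ℝ))⁻¹)⁻¹ * (scH d L mv kk hL k (scShift d L mv kk hL μ₀ x) - scH d L mv kk hL k x)) (hsX' := fun k x' => scH' d L mv kk r hL k (scShift' d L mv kk r hL μ₀ x')) (dhX' := fun k x' => ((((L ^ r * L ^ kk : ℕ) : ℝ))⁻¹)⁻¹ * (scH' d L mv kk r hL k (scShift' d L mv kk r hL μ₀ x') - scH' d L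 mv kk r hL k x')) (cd := π / W) (os := (π * (d + 1) / (((L ^ kk : ℕ) : ℝ) * W) + (π / W)
    / ((((L ^ kk : ℕ) : ℝ))⁻¹)⁻¹)) (od := O1) (ca := ca) (oa := oa)
    (htri := triangle254_unitTorusGeo L kk _) (hd := unitTorusGeo_dist_nonneg L kk _) (hd0 := unitTorusGeo_dist_self L kk _) (hsymm := unitTorusGeo_dist_symm L kk _) (hrow := hrow) (hσ := by positivity) (hcr := hcr0) (hβ := hC.le) (hβ₁ := hC.le) (hct := div_nonneg pi_pos.le hWpos.le) (hm₀ := mul_nonneg hC.le hεk0) (hm₁ := mul_nonneg hC.le hεk0) (hoχ := hoχ0) (hoχ₁ := mul_nonneg zero_le_two hoχ0) (hoχ₂ := hoχ₂0) (hR := hR0.le) (ho := ho0) (hσρ := by linarith only [hδm0]) (hρ₁V := by linarith only [hδm0]) (hρ₁G := by linarith only [hδm0]) (hρ₂ := by positivity) (hρ₂₁ := by linarith only [hδm0]) (hρ₂T := by linarith only [hδm0]) (hρ₃ := by positivity) (hρ₃₂ := by linarith only [hδm0]) (hρ₃V := by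
    linarith only [hδm0]) (hρ₃N := by linarith only [hδm0]) (hσρ₃ := by linarith only [hδm0]) (hε := by positivity) (hc₁ := div_nonneg pi_pos.le hWpos.le) (hc₂ := div_nonneg (by positivity) (pow_nonneg hWpos.le 2)) (ho₁ := ho₁0) (ho₂ := ho₂0) (hrW := le_rfl) (hθW := le_rfl) (hcN := by positivity) (hrN := hRNK0) (hℓ := div_nonneg (by positivity) hWpos.le) (hω := div_nonneg (by positivity) hWpos.le) (hd₁ := zero_le_one) (hoo := hoχ0) (hε₀ := le_rfl) (hrF := le_rfl) (hNov := hNov0) (hn := by rw [hηinv]; exact hnr) (hn' := by rw [hη'inv]; exact hnr') (hSχ := fun k x hx => scBlk_mem_cvSk_of_scChi_ne_zero hM hm₁ hfitI hS0 hx) (hSψ := fun k x hx => scBlk_mem_cvSk_of_scPsi_ne_zero hx) (hSχ' := fun k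
    x' hx => scBlk_kingPr_mem_cvSk_of_scChi'_ne_zero hM hm₁ hfitI hS0 hx) (hSψ' := fun k x' hx => scBlk_kingPr_mem_cvSk_of_scPsi'_ne_zero hx) (hχt := fun k x => abs_bcube_le_one (2 * L) (scXi d L mv kk hL) 2 k x) (hdχt := hdχt) (hdχtb := hdχtb) (hsub := hsub) (hχ := hχ) (hs := hs) (hsb := hsb) (hdd := hdd) (hddb := hddb) (hNψ := hNψ) (hχt' := fun k x => abs_bcube_le_one (2 * L) (scXi' d L mv kk r hL) 2 k x) (hdχt' := hdχt') (hdχtb' := hdχtb') (hsub' := hsub') (hχ' := hχ') (hs' := hs') (hsb' := hsb') (hdd' := hdd') (hddb' := hddb') (hNψ' := hNψ') (hfitχ := hfitχ) (hfit₁ := hfit₁) (hfit₁b := hfit₁b) (hfit₂ := hfit₂) (hfit₂b := hfit₂b) (hcut := hcut) (hcutF := hcutF) (hcutB := hcutB) (hcut' := hcut') (hcutF' := hcutF') (hcutB' := hcutB') (hDcut := hDcut) (hDcutF := hDcutF) (hDcutB := hDcutB) (hs2 := hs2) (hsb2 := hsb2) (hdd2 := hdd2) (hddb2 := hddb2) (hs2'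 := hs2') (hsb2' := hsb2') (hdd2' := hdd2') (hddb2' := hddb2') (hq := hq₀.trans_lt (by norm_num)) (hh1 := hh1) (hh1b := hh1b) (hh1' := hh1') (hh1b' := hh1b') (hh2' := hh2') (hf1 := hf1) (hf1b := hf1b) (hf2 := hf2) (hLip := hLip) (hrh := hrh) (hrh' := hrh') (hfh := hfh) (hstep := fun μ x => tdistT_scBlk_scShift_le μ x) (hstep' := fun μ x' => dist_scBlk_kingPr_scShift'_le μ x') (hKN' := hKN') (hDKN := hDKN) (hh2 := hh2) (hKN := hKN) (hhabs := fun k x => abs_hcube_le_one (2 * L) (scXi d L mv kk hL) k x) (hhabs' := fun k x =>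
    abs_hcube_le_one (2 * L) (scXi' d L mv kk r hL) k x) (hhcut := hhcut) (hhcut' := hhcut') (hN := hN) (hT := hT) (hT' := hT') (hDT := hDT) (he := he) (hu' := hu') (hrV := hrV) (hRN := hRN) (hθF := hθ₀0.le) (hρF := by linarith only [hδm0]) (hrD := hrD) (hoV := hoV) (hoN := hoN) (hRle := hRle) (hole := hole) (hP := hP) (hP' := hP') (hχ1 := fun k x => abs_chiCube_le_one _ _) (hχ1' := fun k x => abs_chiCube_le_one _ _) (hψχ := hψχ) (hψχ' := hψχ') (hCloc := hCloc) (hAloc := hAloc) (hCloc' := hCloc') (hAloc' := hAloc') (hfitC := hfitC) (hfitA := hfitA) (hNVcut := hNVcut) (hNVcut' := hNVcut') (hDNV := hDNV) (hfarN := hfarN) (hfarN' := hfarN') (hDfarN := hDfarN) (hhψ := hhψ) (hχh := hχh) (hhs' := hhs') (hhsb' := hhsb') (hhdd' := hhdd') (hhddb' := hhddb') (hhψf := hhψf) (hχhf := hχhf) (hhsf := hhsf) (hhsbf := hhsbf) (hhddf := hhddf) (hhddbf := hhddbf) (hTk := hTk) (hT0 := rfl) (hΨ := hΨ) (hs0 :=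 hsS0) (hψoχ := hψχ) (hψoh := hψoh) (hKout := hKout) (hSin := hSin) (hSout := hSout) (hq' := hsmall.1)
    (hcd := div_nonneg pi_pos.le hWpos.le) (hos := hos0) (hod := ho₁0) (hca := hca0) (hoa := hoa0) (hleib := fun k => covD_comp_mulOp_scalar _ _ _ _) (hleib' := fun k => covD_comp_mulOp_scalar _ _ _ _) (hhsa' := fun k p => abs_hcube_le_one (2 * L) (scXi' d L mv kk r hL) k (scShift' d L mv kk r hL μ₀ p.1)) (hdha' := fun k p => (by simpa only [fgrad_apply, liftEquiv_apply] using hh1' k μ₀ p)) (hfits := fun k p => abs_shift_fit_of_cross (kingPr L kk r (cvM d L mv kk hL)) (scShift d L mv kk hL μ₀) (scShift' d L mv kk r hL μ₀) (inv_pos.mpr (inv_pos.mpr hnr)) (fun q => hfh k q) (fun q => (by simpa only [fgrad_apply, liftEquiv_apply] using hh1 k μ₀ q)) hcross_ p) (hfitd := fun k p =>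
    (by simpa only [fgrad_apply, liftEquiv_apply, liftMap] using hf1 k μ₀ p)) (hSχe := hSχe_) (hSχe' := fun k => shifted_support_fine_of_cross (g := unitTorusGeo L kk (cvM d L mv kk hL)) (χ := scChi d L mv kk hL k) (χ' := scChi' d L mv kk r hL k) (S := cvSk d L mv kk hL k) (scBlk d L mv kk hL) (kingPr L kk r (cvM d L mv kk hL)) (scShift d L mv kk hL μ₀) (scShift' d L mv kk r hL μ₀) (fun x' => scChi'_eq_scChi_kingPr k x') (fun x hx => scBlk_mem_cvSk_of_scChi_ne_zero hM hm₁ hfitI hS0 hx) (hSχe_ k) hcross_) (ha := fun k x hx i => (by rw [inv_inv]; exact hTa k x hx i)) (ha' := fun k x' hx i => (by rw [inv_inv]; exact hTa' k x' hx i)) (hDa := fun k x' hx i =>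
    (by rw [inv_inv, inv_inv]; exact hTDa k x' hx i)) (hcross := hcross_) (hJout := fun k => mulOp_comp_covD_comp_cut_of_support (χ := scChi d L mv kk hL k) (ψ := scPsi d L mv kk hL k) _ _ _ (fun x hx => (scPsi_near_scChi hM hmg₂ hfg₂ hS0 μ₀ k hx).1) (hψe_ k) _)
  have hsm := cvSmall335J (s := sS) (Nov := Nov) (cι2 := cι2) (cι := (Fintype.card ι : ℝ)) (cJ := (Fintype.card (Fin (d + 1)) : ℝ)) (β := β) (β₁ := β₁) (ct := π / W) (R := R) (cr := cr) (c₁ := π / W) (c₂ := 32 * π ^ 2 / W ^ 2) (θW := 0) (cN := (π * (d + 1) / W * 0 + 2 * (π * (d + 1) / W)) * a₀) (ℓ := π * (d + 1) / W) (ε := δm / 2) (ω := π * (d + 1) / W) (d₁ := 1) (θF := θ₀) (ε₀ := 0) (m₀ := C * εk) (m₁ := C * εk) (oχ := π * (d + 1) / (((L ^ kk : ℕ) : ℝ) * W)) (oχ₁ := 2 * (π * (d + 1) / (((L ^ kk : ℕ) : ℝ) * W))) (oχ₂ := (W)⁻¹ * (((L ^ kk : ℕ) : ℝ) * W)⁻¹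 * (32 * π ^ 4 + π ^ 2 * (d + 1))) (o := o) (o₁ := O1) (o₂ := O2) (rW := 0) (rN := RNK) (oo := π * (d + 1) / (((L ^ kk : ℕ) : ℝ) * W)) (rF := 0) (rD := rD) (η := η)
    (η' := η') (S := Sdef) (ctb := π) (c₁b := π) (c₂b := 32 * π ^ 2) (cNb := (π * (d + 1) * 0 + 2 * (π * (d + 1))) * a₀) (ε₀b := 0) (θFb := θ₀) (LRb := π * (d + 1) * E' + 2 * (π * (d + 1) + π * (d + 1) * 1)) (ks := 1) (km₀ := C) (km₁ := C) (koχ := π * (d + 1)) (koχ₁ := 2 * (π * (d + 1))) (koχ₂ := 32 * π ^ 4 + π ^ 2 * (d + 1)) (ko := 1) (ko₁ := 64 * π ^ 2 + π ^ 2 * Fintype.card (Fin (d + 1))) (ko₂ := 144 * π ^ 3 + 32 * π ^ 3 * Fintype.card (Fin (d + 1))) (krW := 0) (krN := KRN) (koo := π * (d + 1)) (krF := 0) (krD := 1) (kη0 := π) (kη1 := π) (ca := ca) (oa := oa) (cd := π / W) (os := (π * (d + 1) / (((L ^ kk : ℕ) : ℝ) * W) + (π / W) / ((((L ^ kk : ℕ)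 : ℝ))⁻¹)⁻¹)) (od := O1) (ρ₃ := δm / 8)
    (cab := 1) (cdb := π) (E3b := Real.exp (δm / 8 * 1)) (koa := 1) (kos := π * (d + 1) + π) (kod := 64 * π ^ 2 + π ^ 2 * Fintype.card (Fin (d + 1))) (kη := 1)
    hNov0 hcι20 (Nat.cast_nonneg _) (Nat.cast_nonneg _) hβ0 hβ₁0 hR0.le hcr0 le_rfl hca0 hca1 (div_nonneg pi_pos.le hWpos.le) (div_le_self pi_pos.le hW1) (div_nonneg pi_pos.le hWpos.le) (div_le_self pi_pos.le hW1) (div_nonneg pi_pos.le hWpos.le) (div_le_self pi_pos.le hW1) (div_nonneg (by positivity) (pow_nonneg hWpos.le 2)) (div_le_self (by positivity) (by nlinarith only [hW1])) (by positivity) hcNb le_rfl le_rfl hθ₀0.le le_rfl (cv_inv_le_two hq₀).1 (cv_inv_le_two hq₀).2 (cv_inv_le_two' hq₀).1 (cv_inv_le_two' hq₀).2 hLR20 hLRb2 (Real.exp_nonneg _) le_rfl hhalf.1 hhalf.2 hoa0 hsoa hos0 hsos ho₁0 hso₁ hη0 hsη hsS0 hss (mul_nonneg hC.le hεk0) hsm₀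 (mul_nonneg hC.le hεk0) hsm₀ hoχ0 hsoχ (mul_nonneg
    zero_le_two hoχ0) hsoχ₁ hoχ₂0 hsoχ₂ ho0 hso ho₁0 hso₁ ho₂0 hso₂ le_rfl (by rw [zero_mul]) hRNK0 hsRN hoχ0 hsoχ le_rfl (by rw [zero_mul]) hrD hsrD (div_nonneg (div_nonneg pi_pos.le hWpos.le) (inv_nonneg.mpr hη0)) hsDη0 (div_nonneg (div_nonneg pi_pos.le hWpos.le) (inv_nonneg.mpr hη'0)) hsDη1
  refine key.mono fun y y' => ?_
  exact mul_le_mul hsm.2 (Real.exp_le_exp.mpr (le_of_eq (by ring))) (Real.exp_nonneg _) (hsm.1.trans hsm.2)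

end Knit

end Summit.QuantumFields.YangMills.BalabanUVNodes.N15.Gluing

end
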